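/-
Copyright: lit-balaban Phase-2 proof seat p30 (gen 36).  Statement-level skeleton of a published paper; no proof claims beyond what the
kernel checks below.
-/
import Literature.MathematicalPhysics.QuantumFieldTheory.BalabanImbrieJaffe1984to88.BIJ88LocDerivHolder230SmallFieldTorus
import Literature.MathematicalPhysics.QuantumFieldTheory.BalabanImbrieJaffe1984to88.BIJ88LocDeriv230SmoothNearOpTorus

/-!
# `BalabanImbrieJaffe1984to88.BIJ88LocDerivHolder230SmoothNearTorus` — T. Bałaban, J. Imbrie, A. Jaffe, *Effective action and cluster
properties of the abelian Higgs model*, Commun. Math. Phys. **114** (1988) 257–315 [BalabanImbrieJaffe1988], Sect. 2 p. 263 [PDF 7], the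
sentence after (2.33): *"Bounds analogous to (2.30), (2.31) hold for covariant derivatives and Hölder derivatives of G_{k,loc}(u) of order less
than two"* — **THE MEMBER OF TOP ORDER `1 + θ` OF (2.30) FOR `G_{k,loc}(u)`, PRINTED TORUS DATA OF RECORD, UNDER THE PRINTED LOCAL
HYPOTHESIS (2.32)**: the gauge field `u` plaquette-small ONLY on the plaquettes based within `2L^k` of the reference box `Ω₀ ⊇ □_α` (nothing
assumed elsewhere), resp. r18's `SmoothOn` near `Ω₀` BY NAME — p29 gen 29's `BIJ88LocDerivHolder230SmallFieldTorus.derivHolder230_smallField_of_smooth`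
(whose hypotheses are plaquette smallness on the WHOLE torus plus p27's bondwise `(T, δ)` smallness inside `Ω₀`) RE-RUN with its four cube inputs
replaced by p34's LOCAL, gauge-free members — (A) [6] (1.9) `holder19_smoothNear_region_uniform_input` (B-II), (B)/(C) [6] (1.10) derivative
`decay110_smoothNear_region_deriv_uniform` (B-II), (D) [6] (1.10) value `decay110_smoothNear_region` (B-I), each at `Ω = □_α ⊆ Ω₀` (a `k`-block
union near which `u` is plaquette-small) — and, for far pairs, this unit's local derivative member
`BIJ88LocDeriv230SmoothNearOpTorus.deriv230_smoothNear_op_of_lipschitz`; the change of gauge of [BalabanImbrieJaffe1985] p. 326 lives inside p34's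
inputs (`blockGauge_of_near`), so NO bondwise hypothesis and NO gauge condition appears.  This file is the (2.30) «H1θ» cell of the row «u smooth
NEAR Ω ONLY — THE PRINTED (2.32)» of r18's coverage matrix (`lit-balaban-r18/C2S14-CLOSURE.md` §6); its (2.31) twin is p34's
`BIJ88LocDerivHolder231SmoothNearRegion`.

statement-level skeleton of published theorems with citation tags; proofs where landed; nothing here is a claim about the Yang–Mills mass gap

PDF held: `paper:balaban1988-cmp114-bij-abelian-higgs-effective-action` (journal page = PDF page + 256); p. 263 [PDF 7] re-read this session on
the materialised text layer; [BalabanImbrieJaffe1985] = Commun. Math. Phys. **97** (1985) 299–329, (2.7) p. 303 and p. 326 [PDF 28]; [6] =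
[Balaban1983RegularityDecay], Commun. Math. Phys. **89** (1983) 571–597, Theorem p. 573 (1.9): the Hölder quotient of `D^η_{A,μ}G_k(Ω,A)f`
transported *"along a shortest contour connecting these points"*.

CITATION HEADER (lean-in-tree rule).  Part of the lit-balaban TYPED SKELETON (HOME `run/shared/lean/pub/lit-balaban/`), PHASE-2 proof seat
p30 gen 36 (unit `lit-balaban-p30-g36`; free-target protocol G.5-34(d), TAKING line HOME/STATUS.md 2026-08-23T20:09:30Z — file B of the pair
announced there; r18's `C2S14-CLOSURE.md` v1.33 successor list).  Rows **C2.Eq2.30** / **C2.Claim@263** / **C2.Eq2.32** of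
`HOME/lit-balaban-r18/ROWS-C2.md` (owner r18; heads unchanged — LOCATED member; the abstract hence-step of record is p08's `BIJ88HolderDecay230`).
Kind: theorems only (no definition, no `Prop`-valued fact; p29's, p34's, p30's, p27's, r18's declarations used BY NAME, nothing restated; the
four private kernels `rpow_le_self_of_one_le` / `exp_div_le` / `covD_mulVec_sub` / `covD_zero` are p29's private plumbing lemmas of
`BIJ88LocDerivHolder230SmallFieldTorus`, copied with attribution because a private declaration cannot be imported).

THE PRINTED TEXT (p. 263, verbatim, print order).  *"… a straightforward application of the random walk expansion of [6] shows that
|(G_{k,loc}(u)f)(x)| ≦ ce^{−c dist(suppt f,x)}‖f‖_∞, (2.30) … We assume that u is smooth in the □_α's entering the sum in (2.27); for (2.31) we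
assume smoothness throughout the subset Ω ⊂ T_η. This means that in a neighborhood of each □_α there exists an A, λ such that u =
exp[ie_kη(A + ∂λ)] with |∂A|, |∂*A| ≦ O(p(e_k)). (2.32) … Bounds analogous to (2.30), (2.31) hold for covariant derivatives and Hölder derivatives
of G_{k,loc}(u) of order less than two."*

THE MECHANISM (p29's, declared in `BIJ88LocDerivHolder230SmallFieldTorus`; unchanged here except for the inputs — near pairs `|x₁ − x₂|_T ≤ L^k`):
gen 27's bond identity `covD_gLocT_apply` at both bonds and gen 28's four-term split — (A) [6] (1.9) for each cube active at `x₂ + e_μ` on its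
fixed row source (both points `3L^k`-deep in the cube since `R > 4L^k + 1`, `R₀ ≥ 3L^k`), (B) the (1.10) derivative member on the difference of the
row sources of `x₂ + e_μ`, `x₁ + e_μ` (gen 28's `abs_weight_shift_sub_le_of_hull`), (C) the transported difference of the VALUES of the cube
propagators on the bond-difference source of `x₂`, telescoped bond by bond ALONG p30's STAIRCASE (p29's `norm_stairHol_mul_sub_le_of_near`) with
the derivative member per bond, (D) the (1.10) value member on the difference of the bond-difference sources (gen 28's
`abs_weight_bondDiff_sub_le_of_hull`); far pairs: two covariant-derivative members of `G_{k,loc}(u)` (file A), `|U(Γ)| = 1`.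

WHAT IS PROVED (theorems only; 0 `sorry`; standard axioms).
* §2 **`derivHolder230_smoothNear_of_smooth`** — for `d + 1 ∈ {2,3}`, `L` odd `> 1`, `a > 0`, `0 ≤ θ < 1`, moduli `K₁, K₂ ≥ 0` THERE EXIST
  `t₀, c₀ > 0` depending on `(d, L, a, θ, K₁, K₂)` only such that for every volume (`P.d = d+1`, `P.L = L`), every `1 ≤ k ≤ K_P` with
  `2(L^k − 1) + 4 < |T^{(0)}|`, every no-wrap box `Ω₀ = c·L^k + Π_i[0, L^kM₀_i)` shorter than the torus leaving a torus gap `≥ R`, `s ≥ 1`,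
  `W ≥ 2s/3 + R₀/2 + R`, `4L^k + 1 < R`, `0 ≤ R₁ < R₀`, `3L^k ≤ R₀`, every real cut-off `ζ″` (`|ζ″| ≤ 1`, `= 0` beyond `R₀`, first lattice
  differences `≤ K₁/(R₀−R₁)`, second ones `≤ K₂/(R₀−R₁)²`), every `U(1)` field `u` with `‖u(∂p) − 1‖ ≤ θ_p` FOR THE PLAQUETTES BASED WITHIN
  `2L^k` OF `Ω₀`, `2(d+1)³(L^{2k}θ_p)² ≤ 1`, every `T ≥ d(L^k − 1)θ_p` with `2(L^k−1)L^k(d+1)T² + 2((d+1)(L^k−1)T)² ≤ 1/2`, every direction `μ`,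
  all bonds `⟨x₁, x₁+e_μ⟩`, `⟨x₂, x₂+e_μ⟩` with their four end points in `Ω₀` at chart depth `≥ R₀`, every `f` (`‖f‖_∞ ≤ F`) supported at
  sup-torus distance `≥ D ≥ 0` from `x₁` and `x₂`:
  `(L^k/|x₁ − x₂|_T)^θ·‖U(Γ_{x₁,x₂})(D_uG_{k,loc}(u)f)(x₂, μ) − (D_uG_{k,loc}(u)f)(x₁, μ)‖ ≤ (L^kε)·c₀·m·(1 + L^k((R₀ − R₁)⁻¹ + s⁻¹))²·e^{−t₀D/L^k}·F`,
  `m = (⌊(L^k − 1 + R₀)/s⌋ + 3)^{d+1}`, `U(Γ_{x₁,x₂})` = p30's `stairHol u x₁ x₂`;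
* §3 **`derivHolder230_smoothNear_zetaPi`** — §2 for r18's smooth product cut-off `ζ″ = ζ^Π(R₁, R₀)` of (2.29) (`1 ≤ R₁ < R₀ ≤ (|T^{(0)}| − 3)/2`;
  constants from `(d, L, a, θ)` and the universal profile bound `C_σ`);
* §3 **`derivHolder230_smoothOn_zetaPi`** — the same UNDER THE PRINTED (2.32) NEAR `Ω₀`: r18's `SmoothOn e_k η C 𝓅 X B Pl (cfg u)` BY NAME with
  `Pl ⊇` the plaquettes based within `2L^k` of `Ω₀` and `B ⊇` their four bonds (p34's `plaqSmall_near_of_smoothOn`), thresholds at `θ_p = e_kη²C𝓅`.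
HONEST SCOPE / DIVERGENCE.  (i) The hypothesis is LOCAL as printed, in the tree's currency (plaquettes BASED within sup-distance `2L^k` of `Ω₀`;
of `SmoothOn` only the representation and curl clauses are used).  (ii)–(vi) = p29's `BIJ88LocDerivHolder230SmallFieldTorus` HONEST SCOPE
verbatim: `2 ≤ d + 1 ≤ 3`, `L` odd, `1 ≤ k ≤ K_P` (p34's/p27's inputs); NEAR PAIRS ONLY carry the four-term mechanism, far pairs two derivative
members; deep bonds only (`R > 4L^k + 1`, `R₀ ≥ 3L^k`; print has no depth restriction); `U(Γ)` = p30's axis-ordered staircase (one shortest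
contour; [6] allows any); constants existential in `(d, L, a, θ, K₁, K₂)`, not evaluated; `set_option maxHeartbeats 800000` on §2 (elaboration
budget only, as in p29's file).  DIVERGENCE OF METHOD as disclosed in the providers (energy / mean-value / block tree gauges instead of [6]'s
random walk).  Imports: p29's `BIJ88LocDerivHolder230SmallFieldTorus` (its §1–§2 staircase lemmas BY NAME), this unit's file A
`BIJ88LocDeriv230SmoothNearOpTorus` (→ p34's B-I/B-II).  Literature + Mathlib only.  Unit `lit-balaban-p30` (literature-prover-lit-balaban-p30-g36-0),
HOME `run/shared/lean/pub/lit-balaban/`, 2026-08-23.  NOT summit progress, continuum or Clay.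
-/

open scoped BigOperators Matrix ComplexConjugate
open Finset Matrix

namespace Literature.MathematicalPhysics.QuantumFieldTheory.BalabanImbrieJaffe1984to88.BIJ88LocDerivHolder230SmoothNearTorus

open Literature.MathematicalPhysics.QuantumFieldTheory.Balaban1983to89
open LatticeFieldCalculus (supDist)
open BIJ88Sect3Statements (U1 toC cfg covD starB mem_starB norm_toC toC_one)
open BIJ88Sect2Statements (SmoothOn)
open BIJ85BlockAveragesTorus BIJ85BlockAveragesTorusK
open BIJ88NeumannPropagator227Torus (gBox)
open BIJ88DeltaLoc234Torus (gLocT)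
open BIJ88NeumannNoZeroModesTorus (IsBlockUnion)
open BIJ88NeumannPropagatorFlatDecayCube
open BIJ88NeumannPropagatorFlatClose231 (norm_rowSource_le rowSource_ne_zero abs_lam_le_one)
open BIJ88LocWeights227Torus
open BIJ88LocDeriv230FlatTorus (T_shift_le_one abs_T_shift_sub_le covD_gLocT_apply)
open BIJ88LocDeriv230ZetaPiFlatTorus (norm_rowSource_sub_le_of_lipschitz)
open BIJ88LocDerivHolder230FlatTorus (abs_weight_shift_sub_le_of_hull abs_weight_bondDiff_sub_le_of_hull)
open BIJ85ScalarPropagatorHolderDecay (stairHol norm_stairHol)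
open BIJ88LocDerivHolder230SmallFieldTorus (norm_stairHol_mul_sub_le_of_near stairHol_self)
open BIJ88LocDeriv230SmoothNearOpTorus (deriv230_smoothNear_op_of_lipschitz)
open BIJ88NeumannPropagatorSmoothNearRegion (decay110_smoothNear_region plaqSmall_near_of_smoothOn)
open BIJ88NeumannPropagatorSmoothNearRegionHolder (decay110_smoothNear_region_deriv_uniform holder19_smoothNear_region_uniform_input)
open B3Bound323ZeroTorus (T_eq_supDist)
open B4Reflection242 (boxDom mem_boxDom)

noncomputable section

variable {P : Params} {j : ℕ}

/-! ## §1 Private kernels (p29's plumbing lemmas of `BIJ88LocDerivHolder230SmallFieldTorus`, copied with attribution — private there) -/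

section DerivHolder

variable {d : ℕ}

/-- kernel: for `1 ≤ t` and `θ ≤ 1`, `t^θ ≤ t`. [folklore] -/
private theorem rpow_le_self_of_one_le {t θ : ℝ} (ht : 1 ≤ t) (hθ : θ ≤ 1) : t ^ θ ≤ t := by
  have h := Real.rpow_le_rpow_of_exponent_le ht hθ
  rwa [Real.rpow_one] at h

/-- kernel: `exp (-(t₁ * D / n)) ≤ exp (-(t * (n⁻¹ * D)))` for `t ≤ t₁`, `0 < n`, `0 ≤ D`. [folklore] -/
private theorem exp_div_le {t t₁ n D : ℝ} (ht : t ≤ t₁) (hn : 0 < n) (hD : 0 ≤ D) :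
    Real.exp (-(t₁ * D / n)) ≤ Real.exp (-(t * (n⁻¹ * D))) := by
  refine Real.exp_le_exp.2 (neg_le_neg ?_)
  rw [mul_comm n⁻¹ D, ← div_eq_mul_inv, mul_div_assoc]
  exact mul_le_mul_of_nonneg_right ht (div_nonneg hD hn.le)

/-- kernel: `D_u(Gf) − D_u(Gg) = D_u(G(f − g))`. [cite: BalabanImbrieJaffe1988, (3.2) p.265] -/
private theorem covD_mulVec_sub (c' : ℝ) (u : PBond P 0 → ℂ) (G : Matrix (Balaban1983to89.Site P 0) (Balaban1983to89.Site P 0) ℂ)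
    (f g : Balaban1983to89.Site P 0 → ℂ) (b : PBond P 0) :
    covD c' u (G *ᵥ f) b - covD c' u (G *ᵥ g) b = covD c' u (G *ᵥ (f - g)) b := by
  simp only [covD, Matrix.mulVec_sub, Pi.sub_apply]
  ring

/-- kernel: `D_u` of the zero function vanishes. [cite: BalabanImbrieJaffe1988, (3.2) p.265] -/
private theorem covD_zero (c' : ℝ) (u : PBond P 0 → ℂ) (b : PBond P 0) : covD c' u (0 : Balaban1983to89.Site P 0 → ℂ) b = 0 := by
  simp only [covD, Pi.zero_apply, mul_zero, sub_zero]

/-! ## §2 The Hölder member of order `1 + θ` of (2.30) under plaquette smallness NEAR `Ω₀` ONLY -/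

set_option maxHeartbeats 800000 in
/-- **THE HÖLDER MEMBER OF ORDER `1 + θ` (`0 ≤ θ < 1`) OF (2.30) FOR `G_{k,loc}(u)` UNDER PLAQUETTE SMALLNESS NEAR THE REFERENCE BOX `Ω₀`
ONLY, FOR THE TORUS CUBES AND WEIGHTS OF RECORD AND A SMOOTH CUT-OFF** (p. 263: *"We assume that u is smooth in the □_α's entering the sum in
(2.27) … in a neighborhood of each □_α … (2.32) … Bounds analogous to (2.30), (2.31) hold for covariant derivatives and Hölder derivatives of
G_{k,loc}(u) of order less than two"*; [BalabanImbrieJaffe1985] p. 326 *"by change of gauge u_k can be transformed in a local region Λ"*).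
p29's `derivHolder230_smallPlaquette_of_smooth` VERBATIM IN SHAPE — same constants-dependence `(d, L, a, θ, K₁, K₂)`, same geometry
(`2(L^k − 1) + 4 < |T^{(0)}|`, no-wrap box `Ω₀` with torus gap `≥ R`, `s ≥ 1`, `W ≥ 2s/3 + R₀/2 + R`, `4L^k + 1 < R`, `0 ≤ R₁ < R₀`, `3L^k ≤ R₀`),
same smooth cut-off hypotheses, same thresholds `2(d+1)³(L^{2k}θ_p)² ≤ 1`, `T ≥ d(L^k − 1)θ_p`, `2(L^k−1)L^k(d+1)T² + 2((d+1)(L^k−1)T)² ≤ 1/2`,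
same deep bonds, same conclusion
`(L^k/|x₁ − x₂|_T)^θ·‖U(Γ_{x₁,x₂})(D_uG_{k,loc}(u)f)(x₂,μ) − (D_uG_{k,loc}(u)f)(x₁,μ)‖ ≤ (L^kε)·c₀·m·(1 + L^k((R₀−R₁)⁻¹ + s⁻¹))²·e^{−t₀D/L^k}·F` —
EXCEPT that `‖u(∂p) − 1‖ ≤ θ_p` is asked ONLY of the plaquettes based within sup-distance `2L^k` of `Ω₀`; the cube inputs are p34's LOCAL
gauge-free members at `Ω = □_α ⊆ Ω₀` (B-II `holder19_smoothNear_region_uniform_input`, `decay110_smoothNear_region_deriv_uniform`; B-I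
`decay110_smoothNear_region`) and the far-pair input is file A's `deriv230_smoothNear_op_of_lipschitz`.
[cite: BalabanImbrieJaffe1988, (2.30) p.263] [cite: BalabanImbrieJaffe1988, (2.32) p.263] [cite: Balaban1983RegularityDecay, Theorem p.573 (1.9)] -/
theorem derivHolder230_smoothNear_of_smooth (d L : ℕ) (hd1 : 1 ≤ d) (hd3 : d + 1 ≤ 3) (hL : Odd L ∧ 1 < L) {a : ℝ} (ha : 0 < a)
    {θ : ℝ} (hθ0 : 0 ≤ θ) (hθ1 : θ < 1) {K₁ K₂ : ℝ} (hK₁ : 0 ≤ K₁) (hK₂ : 0 ≤ K₂) :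
    ∃ t₀ c₀ : ℝ, 0 < t₀ ∧ 0 < c₀ ∧ ∀ (P : Params) (hPd : P.d = d + 1), P.L = L →
      ∀ k : ℕ, 1 ≤ k → k ≤ P.K → 2 * (P.L ^ k - 1) + 4 < P.sitesPerDir 0 → ∀ (c M0 : Fin (d + 1) → ℕ), (∀ i, 1 ≤ M0 i) →
        (∀ i, c i * P.L ^ k + P.L ^ k * M0 i ≤ P.sitesPerDir 0) → (∀ i, P.L ^ k * M0 i < P.sitesPerDir 0) →
      ∀ (s W : ℕ), 1 ≤ s → ∀ (R R₀ R₁ : ℝ), 4 * (P.L : ℝ) ^ k + 1 < R → 0 ≤ R₁ → R₁ < R₀ → 3 * (P.L : ℝ) ^ k ≤ R₀ →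
        2 * (s : ℝ) / 3 + R₀ / 2 + R ≤ W → (∀ i, ((P.L ^ k * M0 i : ℕ) : ℝ) + R ≤ P.sitesPerDir 0) →
      ∀ (ζ : Balaban1983to89.Site P 0 → Balaban1983to89.Site P 0 → ℝ), (∀ x y, |ζ x y| ≤ 1) →
        (∀ x y, R₀ ≤ B5Ineq137Torus.T P 0 x y → ζ x y = 0) →
        (∀ (x y : Balaban1983to89.Site P 0) (ν : Fin P.d), |ζ (x.shift ν) y - ζ x y| ≤ K₁ / (R₀ - R₁)) →
        (∀ (x y : Balaban1983to89.Site P 0) (κ ν : Fin P.d),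
          |ζ ((x.shift ν).shift κ) y - ζ (x.shift ν) y - ζ (x.shift κ) y + ζ x y| ≤ K₂ / (R₀ - R₁) ^ 2) →
      ∀ (U : GaugeField P 0 U1) (θp : ℝ), 0 ≤ θp →
        (∀ p : Balaban1983to89.Plaq P 0, (∃ y ∈ (cubeT hPd (P.L ^ k) c fun i => P.L ^ k * M0 i), supDist y p.src ≤ 2 * P.L ^ k) →
          ‖toC (GaugeField.plaqHol U p) - 1‖ ≤ θp) →
        2 * (P.d : ℝ) ^ 3 * (((P.L : ℝ) ^ k) ^ 2 * θp) ^ 2 ≤ 1 →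
      ∀ (T : ℝ), ((P.d - 1 : ℕ) : ℝ) * ((P.L : ℝ) ^ k - 1) * θp ≤ T →
        2 * (((P.L : ℝ) ^ k - 1) * (P.L : ℝ) ^ k) * P.d * T ^ 2 + 2 * (P.d * ((P.L : ℝ) ^ k - 1) * T) ^ 2 ≤ 1 / 2 →
      ∀ (x₁ x₂ : Balaban1983to89.Site P 0) (μ : Fin P.d),
        x₁ ∈ (cubeT hPd (P.L ^ k) c fun i => P.L ^ k * M0 i) →
        (∀ i, R₀ ≤ (boxCoord hPd (P.L ^ k) c x₁ i : ℝ) ∧ (boxCoord hPd (P.L ^ k) c x₁ i : ℝ) + R₀ ≤ (P.L ^ k * M0 i : ℕ) - 1) →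
        x₁.shift μ ∈ (cubeT hPd (P.L ^ k) c fun i => P.L ^ k * M0 i) →
        (∀ i, R₀ ≤ (boxCoord hPd (P.L ^ k) c (x₁.shift μ) i : ℝ) ∧
          (boxCoord hPd (P.L ^ k) c (x₁.shift μ) i : ℝ) + R₀ ≤ (P.L ^ k * M0 i : ℕ) - 1) →
        x₂ ∈ (cubeT hPd (P.L ^ k) c fun i => P.L ^ k * M0 i) →
        (∀ i, R₀ ≤ (boxCoord hPd (P.L ^ k) c x₂ i : ℝ) ∧ (boxCoord hPd (P.L ^ k) c x₂ i : ℝ) + R₀ ≤ (P.L ^ k * M0 i : ℕ) - 1) →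
        x₂.shift μ ∈ (cubeT hPd (P.L ^ k) c fun i => P.L ^ k * M0 i) →
        (∀ i, R₀ ≤ (boxCoord hPd (P.L ^ k) c (x₂.shift μ) i : ℝ) ∧
          (boxCoord hPd (P.L ^ k) c (x₂.shift μ) i : ℝ) + R₀ ≤ (P.L ^ k * M0 i : ℕ) - 1) →
      ∀ (f : Balaban1983to89.Site P 0 → ℂ) (F D : ℝ), (∀ y, ‖f y‖ ≤ F) → 0 ≤ D →
        (∀ y, f y ≠ 0 → D ≤ B5Ineq137Torus.T P 0 x₁ y) → (∀ y, f y ≠ 0 → D ≤ B5Ineq137Torus.T P 0 x₂ y) →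
        ((P.L : ℝ) ^ k / B5Ineq137Torus.T P 0 x₁ x₂) ^ θ *
          ‖stairHol U x₁ x₂ *
              covD P.eps⁻¹ (cfg U)
                (gLocT (B1RG242Torus.α P a k * (P.L : ℝ) ^ (k * P.d)) P.eps⁻¹ U k
                  (cubeFam hPd (P.L ^ k) c M0 s W) (lamFam hPd (P.L ^ k) c M0 s) ζ *ᵥ f) ⟨x₂, μ⟩ -
            covD P.eps⁻¹ (cfg U)
                (gLocT (B1RG242Torus.α P a k * (P.L : ℝ) ^ (k * P.d)) P.eps⁻¹ U k
                  (cubeFam hPd (P.L ^ k) c M0 s W) (lamFam hPd (P.L ^ k) c M0 s) ζ *ᵥ f) ⟨x₁, μ⟩‖ ≤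
          P.spacing k * (c₀ * (⌊(((P.L : ℝ) ^ k) - 1 + R₀) / s⌋₊ + 3) ^ (d + 1) *
            (1 + (P.L : ℝ) ^ k * ((R₀ - R₁)⁻¹ + (s : ℝ)⁻¹)) ^ 2 * Real.exp (-(t₀ * (((P.L : ℝ) ^ k)⁻¹ * D))) * F) := by
  obtain ⟨δH, cH, hδH, hcH, HH⟩ := holder19_smoothNear_region_uniform_input d L hd1 hd3 hL ha hθ0 hθ1
  obtain ⟨δ₁, c₁, hδ₁, hc₁, H1⟩ := decay110_smoothNear_region_deriv_uniform d L hd1 hd3 hL ha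
  obtain ⟨δ₂, c₂, hδ₂, hc₂, H2⟩ := decay110_smoothNear_region d (L - 1) hd3 (by omega) ha
  obtain ⟨δg, cg, hδg, hcg, Hg⟩ := deriv230_smoothNear_op_of_lipschitz d L hd1 hd3 hL ha hK₁
  -- the constants
  set Λ₀ : ℝ := max K₁ (3 * Real.pi * (d + 1 : ℕ) / 2) with hΛ₀def
  have hΛ₀0 : 0 ≤ Λ₀ := hK₁.trans (le_max_left _ _)
  set Λ₀₂ : ℝ := K₂ + 4 * Real.pi ^ 2 + 3 * Real.pi * (d + 1 : ℕ) * K₁ with hΛ₀₂def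
  have hΛ₀₂0 : 0 ≤ Λ₀₂ := by rw [hΛ₀₂def]; positivity
  set CB : ℝ := 2 * ((d : ℝ) + 1) * Λ₀ * c₁ with hCBdef
  set CC : ℝ := 2 * ((d : ℝ) + 1) * Real.exp δ₁ * Λ₀ * c₁ with hCCdef
  set CD : ℝ := 4 * ((d : ℝ) + 1) * Λ₀₂ * c₂ with hCDdef
  have hCB0 : 0 ≤ CB := by rw [hCBdef]; positivity
  have hCC0 : 0 ≤ CC := by rw [hCCdef]; positivity
  have hCD0 : 0 ≤ CD := by rw [hCDdef]; positivity
  set C : ℝ := cH + CB + CC + CD + 2 * cg with hCdef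
  have hC0 : 0 < C := by rw [hCdef]; positivity
  refine ⟨min (min δH δ₁) (min δ₂ δg), C, lt_min (lt_min hδH hδ₁) (lt_min hδ₂ hδg), hC0, ?_⟩
  intro P hPd hPL k hk1 hkK hRsz c M0 hM0 hfit0 hN0 s W hs R R₀ R₁ hR hR₁ hR10 hLR₀ hW hgap ζ hζabs hζ0 hζ1 hζ2 U θp hθp0 hplaq hθps
    T hT hsmallT x₁ x₂ μ hx₁ hdeep₁ hx₁e hdeep₁e hx₂ hdeep₂ hx₂e hdeep₂e f F D hF hD hsupp₁ hsupp₂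
  have hPL' : P.L = L - 1 + 1 := by omega
  set δ := min (min δH δ₁) (min δ₂ δg) with hδdef
  have hδH' : δ ≤ δH := (min_le_left _ _).trans (min_le_left _ _)
  have hδ1 : δ ≤ δ₁ := (min_le_left _ _).trans (min_le_right _ _)
  have hδ2 : δ ≤ δ₂ := (min_le_right _ _).trans (min_le_left _ _)
  have hδg' : δ ≤ δg := (min_le_right _ _).trans (min_le_right _ _)
  -- elementary facts
  have hn : 1 ≤ P.L ^ k := Nat.one_le_pow _ _ P.L_pos
  have hk : 0 + k ≤ P.m + P.K := by omega
  have hkmK : k ≤ P.m + P.K := by omega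
  have hLpos : (0 : ℝ) < P.L := P.cast_L_pos
  have hLk : (0 : ℝ) < (P.L : ℝ) ^ k := pow_pos hLpos _
  have hLk1 : (1 : ℝ) ≤ (P.L : ℝ) ^ k := by exact_mod_cast hn
  have hLkinv : 0 < ((P.L : ℝ) ^ k)⁻¹ := inv_pos.mpr hLk
  have hR1 : 1 < R := by linarith only [hR, hLk]
  have hR0 : 0 ≤ R := by linarith only [hR, hLk]
  have hRL : (P.L : ℝ) ^ k + 1 ≤ R := by linarith only [hR, hLk]
  have hR₀ : 0 ≤ R₀ := hR₁.trans hR10.le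
  have hR₀1 : 1 ≤ R₀ := by linarith only [hLk1, hLR₀]
  have hLR₀' : (P.L : ℝ) ^ k ≤ R₀ := by linarith only [hLR₀, hLk]
  have hs0 : 0 < s := hs
  have hsr : (0 : ℝ) < s := by exact_mod_cast hs0
  have hgap' : 0 < R₀ - R₁ := sub_pos.2 hR10
  have hF0 : 0 ≤ F := (norm_nonneg _).trans (hF x₁)
  have hsp0 : 0 < P.spacing k := P.spacing_pos k
  have heps : 0 < P.eps := P.eps_pos
  have hK₁' : 0 ≤ K₁ / (R₀ - R₁) := div_nonneg hK₁ hgap'.le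
  have hPdR : (P.d : ℝ) = (d : ℝ) + 1 := by rw [hPd]; push_cast; ring
  -- the torus cubes `□_α ⊆ Ω₀` are `k`-block unions; a plaquette based within `2L^k` of `□_α` is based within `2L^k` of `Ω₀`
  have hcubeBU : ∀ α : ↥(labels (P.L ^ k) M0 s), IsBlockUnion k (cubeFam hPd (P.L ^ k) c M0 s W α) := fun α => by
    obtain ⟨c', M', -, hfit', -, e⟩ := cubeFam_fits (hPd := hPd) (s := s) (W := W) hM0 hfit0 hN0 α
    rw [e]; exact isBlockUnion_cubeT hPd hkmK rfl hfit'
  have hplaqα : ∀ (α : ↥(labels (P.L ^ k) M0 s)) (p : Balaban1983to89.Plaq P 0),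
      (∃ y ∈ cubeFam hPd (P.L ^ k) c M0 s W α, supDist y p.src ≤ 2 * P.L ^ k) → ‖toC (GaugeField.plaqHol U p) - 1‖ ≤ θp :=
    fun α p ⟨y, hy, hyp⟩ => hplaq p ⟨y, cubeOf_subset (hPd := hPd) (n := P.L ^ k) (c := c) (M0 := M0) (s := s) (W := W) α.1 hy, hyp⟩
  -- abbreviations
  set Ω₀ : Finset (Balaban1983to89.Site P 0) := cubeT hPd (P.L ^ k) c fun i => P.L ^ k * M0 i with hΩ₀def
  set A : ℝ := B1RG242Torus.α P a k * (P.L : ℝ) ^ (k * P.d) with hAdef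
  set x₁' := x₁.shift μ with hx₁'def
  set x₂' := x₂.shift μ with hx₂'def
  set T12 : ℝ := B5Ineq137Torus.T P 0 x₁ x₂ with hT12def
  have hT0 : 0 ≤ T12 := B5Ineq137Torus.T_nonneg P 0 x₁ x₂
  have hT12N : T12 = (supDist x₁ x₂ : ℝ) := T_eq_supDist P x₁ x₂
  set m : ℝ := ((⌊(((P.L : ℝ) ^ k) - 1 + R₀) / s⌋₊ : ℝ) + 3) ^ (d + 1) with hmdef
  have hm0 : 0 ≤ m := by rw [hmdef]; positivity
  set uv : ℝ := (R₀ - R₁)⁻¹ + (s : ℝ)⁻¹ with huvdef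
  have huv0 : 0 ≤ uv := by rw [huvdef]; positivity
  set br : ℝ := 1 + (P.L : ℝ) ^ k * uv with hbrdef
  have hbr1 : 1 ≤ br := by rw [hbrdef]; exact le_add_of_nonneg_right (by positivity)
  have hbr0 : 0 ≤ br := zero_le_one.trans hbr1
  have hbr2 : br ≤ br ^ 2 := by
    calc br = 1 * br := (one_mul _).symm
      _ ≤ br * br := mul_le_mul_of_nonneg_right hbr1 hbr0
      _ = br ^ 2 := (sq br).symm
  have hLuv : (P.L : ℝ) ^ k * uv ≤ br := by rw [hbrdef]; exact le_add_of_nonneg_left zero_le_one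
  set Ex : ℝ := Real.exp (-(δ * (((P.L : ℝ) ^ k)⁻¹ * D))) with hEdef
  have hE0 : 0 < Ex := Real.exp_pos _
  have hεD : 0 ≤ ((P.L : ℝ) ^ k)⁻¹ * D := mul_nonneg hLkinv.le hD
  have hEH : Real.exp (-(δH * (((P.L : ℝ) ^ k)⁻¹ * D))) ≤ Ex := Real.exp_le_exp.2 (neg_le_neg (mul_le_mul_of_nonneg_right hδH' hεD))
  have hE1 : Real.exp (-(δ₁ * D / (P.L : ℝ) ^ k)) ≤ Ex := exp_div_le hδ1 hLk hD
  have hE2 : Real.exp (-(δ₂ * D / (P.L : ℝ) ^ k)) ≤ Ex := exp_div_le hδ2 hLk hD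
  have hEg : Real.exp (-(δg * (((P.L : ℝ) ^ k)⁻¹ * D))) ≤ Ex := Real.exp_le_exp.2 (neg_le_neg (mul_le_mul_of_nonneg_right hδg' hεD))
  -- the support of the sources in p27's/p34's `supDist` form
  have hsuppN : ∀ (x : Balaban1983to89.Site P 0) (g : Balaban1983to89.Site P 0 → ℂ) (E : ℝ),
      (∀ y, g y ≠ 0 → E ≤ B5Ineq137Torus.T P 0 x y) → ∀ z, g z ≠ 0 → E ≤ (supDist x z : ℝ) := by
    intro x g E hg z hz
    rw [← T_eq_supDist P x z]
    exact hg z hz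
  -- the weight
  set w : ℝ := ((P.L : ℝ) ^ k / T12) ^ θ with hwdef
  have hw0 : 0 ≤ w := Real.rpow_nonneg (div_nonneg hLk.le hT0) θ
  -- the target, factorised
  have hRHS : P.spacing k * (C * m * br ^ 2 * Ex * F) =
      P.spacing k * (C * (⌊(((P.L : ℝ) ^ k) - 1 + R₀) / s⌋₊ + 3) ^ (d + 1) *
        (1 + (P.L : ℝ) ^ k * ((R₀ - R₁)⁻¹ + (s : ℝ)⁻¹)) ^ 2 * Real.exp (-(δ * (((P.L : ℝ) ^ k)⁻¹ * D))) * F) := by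
    rw [hmdef, hbrdef, huvdef, hEdef]
  rw [← hRHS]
  have hRHS0 : 0 ≤ P.spacing k * (C * m * br ^ 2 * Ex * F) := by positivity
  -- coincident points: the difference vanishes
  by_cases hne : x₂ = x₁
  · rw [hne, stairHol_self, one_mul, sub_self, norm_zero, mul_zero]
    exact hRHS0
  by_cases hnear : (P.L : ℝ) ^ k < T12
  · -- FAR PAIRS: two derivative members (file A's `deriv230_smoothNear_op_of_lipschitz`)
    have hTpos : 0 < T12 := hLk.trans hnear
    have hw1 : w ≤ 1 := by
      refine Real.rpow_le_one (div_nonneg hLk.le hT0) ?_ hθ0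
      rw [div_le_one hTpos]; exact hnear.le
    have hg₁ := Hg P hPd hPL k hk1 hkK hRsz c M0 hM0 hfit0 hN0 s W hs R R₀ R₁ hRL hR₁ hR10 hLR₀' hW hgap ζ hζabs hζ0 hζ1 U θp hθp0 hplaq
      hθps T hT hsmallT x₁ μ hx₁ hdeep₁ hx₁e hdeep₁e f F D hF hD hsupp₁
    have hg₂ := Hg P hPd hPL k hk1 hkK hRsz c M0 hM0 hfit0 hN0 s W hs R R₀ R₁ hRL hR₁ hR10 hLR₀' hW hgap ζ hζabs hζ0 hζ1 U θp hθp0 hplaq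
      hθps T hT hsmallT x₂ μ hx₂ hdeep₂ hx₂e hdeep₂e f F D hF hD hsupp₂
    set X₁ := covD P.eps⁻¹ (cfg U) (gLocT A P.eps⁻¹ U k (cubeFam hPd (P.L ^ k) c M0 s W) (lamFam hPd (P.L ^ k) c M0 s) ζ *ᵥ f) ⟨x₁, μ⟩
      with hX₁def
    set X₂ := covD P.eps⁻¹ (cfg U) (gLocT A P.eps⁻¹ U k (cubeFam hPd (P.L ^ k) c M0 s W) (lamFam hPd (P.L ^ k) c M0 s) ζ *ᵥ f) ⟨x₂, μ⟩
      with hX₂def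
    have hBg : ∀ X : ℝ, X ≤ P.spacing k * (cg * (⌊(((P.L : ℝ) ^ k) - 1 + R₀) / s⌋₊ + 3) ^ (d + 1) *
        (1 + (P.L : ℝ) ^ k * ((R₀ - R₁)⁻¹ + (s : ℝ)⁻¹)) * Real.exp (-(δg * (((P.L : ℝ) ^ k)⁻¹ * D))) * F) →
        X ≤ P.spacing k * (cg * m * br * Ex * F) := fun X hX => by
      rw [← hmdef, ← huvdef, ← hbrdef] at hX
      exact hX.trans (mul_le_mul_of_nonneg_left (mul_le_mul_of_nonneg_right (mul_le_mul_of_nonneg_left hEg (by positivity)) hF0) hsp0.le)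
    have h1 : ‖X₁‖ ≤ P.spacing k * (cg * m * br * Ex * F) := hBg _ hg₁
    have h2 : ‖X₂‖ ≤ P.spacing k * (cg * m * br * Ex * F) := hBg _ hg₂
    have hτ : ‖stairHol U x₁ x₂ * X₂‖ = ‖X₂‖ := by rw [norm_mul, norm_stairHol, one_mul]
    calc w * ‖stairHol U x₁ x₂ * X₂ - X₁‖ ≤ 1 * ‖stairHol U x₁ x₂ * X₂ - X₁‖ := mul_le_mul_of_nonneg_right hw1 (norm_nonneg _)
      _ ≤ ‖stairHol U x₁ x₂ * X₂‖ + ‖X₁‖ := by rw [one_mul]; exact norm_sub_le _ _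
      _ ≤ P.spacing k * (cg * m * br * Ex * F) + P.spacing k * (cg * m * br * Ex * F) := by rw [hτ]; exact add_le_add h2 h1
      _ = P.spacing k * ((2 * cg) * m * br * Ex * F) := by ring
      _ ≤ P.spacing k * (C * m * br ^ 2 * Ex * F) := by
          refine mul_le_mul_of_nonneg_left ?_ hsp0.le
          have hc : 2 * cg ≤ C := by rw [hCdef]; linarith only [hcH.le, hCB0, hCC0, hCD0]
          have h3 : (2 * cg) * m * br ≤ C * m * br ^ 2 := mul_le_mul (mul_le_mul_of_nonneg_right hc hm0) hbr2 hbr0 (by positivity)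
          exact mul_le_mul_of_nonneg_right (mul_le_mul_of_nonneg_right h3 hE0.le) hF0
  /- NEAR PAIRS -/
  push Not at hnear
  -- chart coordinates
  obtain ⟨hz₁, hxz₁⟩ := cubePt_boxCoord hPd hfit0 hx₁
  obtain ⟨hz₂, hxz₂⟩ := cubePt_boxCoord hPd hfit0 hx₂
  set z₁ := boxCoord hPd (P.L ^ k) c x₁ with hz₁def
  set z₂ := boxCoord hPd (P.L ^ k) c x₂ with hz₂def
  have hdeepT : ∀ i, T12 ≤ (z₁ i : ℝ) ∧ (z₁ i : ℝ) + T12 ≤ (P.L ^ k * M0 i : ℕ) - 1 := fun i => by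
    have h1 := hdeep₁ i
    constructor <;> linarith only [h1.1, h1.2, hnear, hLR₀']
  have hclose : ∀ i, ((|z₁ i - z₂ i| : ℤ) : ℝ) ≤ T12 := (mem_and_abs_sub_le_of_T_le hPd hfit0 hdeepT le_rfl).2
  have hroom₁ : ∀ j, z₁ j + 1 < ((P.L ^ k * M0 j : ℕ) : ℤ) := fun j => by
    have h1 : ((z₁ j : ℤ) : ℝ) + 2 ≤ ((P.L ^ k * M0 j : ℕ) : ℝ) := by linarith only [(hdeep₁ j).2, hR₀1]
    have h2 : z₁ j + 2 ≤ ((P.L ^ k * M0 j : ℕ) : ℤ) := by exact_mod_cast h1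
    omega
  have hroom₂ : ∀ j, z₂ j + 1 < ((P.L ^ k * M0 j : ℕ) : ℤ) := fun j => by
    have h1 : ((z₂ j : ℤ) : ℝ) + 2 ≤ ((P.L ^ k * M0 j : ℕ) : ℝ) := by linarith only [(hdeep₂ j).2, hR₀1]
    have h2 : z₂ j + 2 ≤ ((P.L ^ k * M0 j : ℕ) : ℤ) := by exact_mod_cast h1
    omega
  have hl1 : ∑ j, ((|z₂ j - z₁ j| : ℤ) : ℝ) ≤ ((d : ℝ) + 1) * T12 := by
    calc ∑ j, ((|z₂ j - z₁ j| : ℤ) : ℝ) ≤ ∑ _j : Fin (d + 1), T12 :=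
          Finset.sum_le_sum fun j _ => by rw [abs_sub_comm]; exact hclose j
      _ = ((d : ℝ) + 1) * T12 := by rw [Finset.sum_const, Finset.card_univ, Fintype.card_fin, nsmul_eq_mul]; push_cast; ring
  -- the shortened support distance near `x₁`
  set D' : ℝ := max (D - T12) 0 with hD'def
  have hD'0 : 0 ≤ D' := le_max_right _ _
  have hexpD' : Real.exp (-(δ₁ * D' / (P.L : ℝ) ^ k)) ≤ Real.exp δ₁ * Ex := by
    have h1 : D - T12 ≤ D' := le_max_left _ _
    have h2 : ((P.L : ℝ) ^ k)⁻¹ * T12 ≤ 1 := by rw [inv_mul_le_iff₀ hLk, mul_one]; exact hnear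
    have e0 : δ₁ * D' / (P.L : ℝ) ^ k = δ₁ * (((P.L : ℝ) ^ k)⁻¹ * D') := by ring
    have h3 : -(δ₁ * (((P.L : ℝ) ^ k)⁻¹ * D')) ≤ δ₁ + -(δ * (((P.L : ℝ) ^ k)⁻¹ * D)) := by
      have h4 : δ₁ * (((P.L : ℝ) ^ k)⁻¹ * (D - T12)) ≤ δ₁ * (((P.L : ℝ) ^ k)⁻¹ * D') :=
        mul_le_mul_of_nonneg_left (mul_le_mul_of_nonneg_left h1 hLkinv.le) hδ₁.le
      have h5 : δ * (((P.L : ℝ) ^ k)⁻¹ * D) ≤ δ₁ * (((P.L : ℝ) ^ k)⁻¹ * D) := mul_le_mul_of_nonneg_right hδ1 hεD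
      have h6 : δ₁ * (((P.L : ℝ) ^ k)⁻¹ * T12) ≤ δ₁ * 1 := mul_le_mul_of_nonneg_left h2 hδ₁.le
      have h7 : δ₁ * (((P.L : ℝ) ^ k)⁻¹ * (D - T12)) = δ₁ * (((P.L : ℝ) ^ k)⁻¹ * D) - δ₁ * (((P.L : ℝ) ^ k)⁻¹ * T12) := by ring
      linarith only [h4, h5, h6, h7]
    calc Real.exp (-(δ₁ * D' / (P.L : ℝ) ^ k)) = Real.exp (-(δ₁ * (((P.L : ℝ) ^ k)⁻¹ * D'))) := by rw [e0]
      _ ≤ Real.exp (δ₁ + -(δ * (((P.L : ℝ) ^ k)⁻¹ * D))) := Real.exp_le_exp.2 h3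
      _ = Real.exp δ₁ * Ex := by rw [Real.exp_add]
  -- the weight against one factor `T12`: `w·T12 ≤ L^k`
  have hwT : w * T12 ≤ (P.L : ℝ) ^ k := by
    rcases hT0.eq_or_lt with hT00 | hTpos
    · rw [← hT00, mul_zero]; exact hLk.le
    · have hq : 1 ≤ (P.L : ℝ) ^ k / T12 := by rw [le_div_iff₀ hTpos, one_mul]; exact hnear
      calc w * T12 ≤ (P.L : ℝ) ^ k / T12 * T12 := mul_le_mul_of_nonneg_right (rpow_le_self_of_one_le hq hθ1.le) hT0
        _ = (P.L : ℝ) ^ k := div_mul_cancel₀ _ hTpos.ne'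
  -- distances between the four end points
  have hT2'2 : B5Ineq137Torus.T P 0 x₂' x₂ ≤ 1 := by rw [B5Ineq137Torus.T_symm]; exact T_shift_le_one x₂ μ
  have hT1'1 : B5Ineq137Torus.T P 0 x₁' x₁ ≤ 1 := by rw [B5Ineq137Torus.T_symm]; exact T_shift_le_one x₁ μ
  have hT21 : B5Ineq137Torus.T P 0 x₂ x₁ = T12 := by rw [B5Ineq137Torus.T_symm]
  have hT2'1 : B5Ineq137Torus.T P 0 x₂' x₁ ≤ 1 + T12 := by
    have := B5Ineq137Torus.T_triangle P 0 x₂' x₂ x₁; linarith only [this, hT2'2, hT21]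
  have hT2'1' : B5Ineq137Torus.T P 0 x₂' x₁' ≤ 2 + T12 := by
    have h1 := B5Ineq137Torus.T_triangle P 0 x₂' x₁ x₁'; have h2 := T_shift_le_one (P := P) x₁ μ; linarith only [h1, h2, hT2'1]
  -- the active-label sets of the four end points
  have hmem : ∀ x : Balaban1983to89.Site P 0, x ∈ blockK k (blkIter k x) := fun x => mem_blockK.2 rfl
  set S : Balaban1983to89.Site P 0 → Finset ↥(labels (P.L ^ k) M0 s) := fun p =>
    (activeLabels hPd (P.L ^ k) c s R₀ (blkIter k p)).subtype fun α => α ∈ labels (P.L ^ k) M0 s with hSdef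
  have hcard : ∀ p, ((S p).card : ℝ) ≤ m := fun p => by
    have h1 := card_subtype_activeLabels_le (hPd := hPd) (c := c) (M0 := M0) hn hs0 hR₀ (blkIter k p)
    have e : (((P.L ^ k : ℕ) : ℕ) : ℝ) = (P.L : ℝ) ^ k := by push_cast; rfl
    rw [e] at h1; exact h1
  have hS : ∀ (p : Balaban1983to89.Site P 0),
      (∀ i, R₀ ≤ (boxCoord hPd (P.L ^ k) c p i : ℝ) ∧ (boxCoord hPd (P.L ^ k) c p i : ℝ) + R₀ ≤ (P.L ^ k * M0 i : ℕ) - 1) →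
      ∀ (α : ↥(labels (P.L ^ k) M0 s)) (y : Balaban1983to89.Site P 0), ζ p y * lamFam hPd (P.L ^ k) c M0 s α p y ≠ 0 → α ∈ S p := by
    intro p hdeep α y hne'
    rw [hSdef, Finset.mem_subtype]
    exact mem_activeLabels_of_ne_zero_of_deep hk hs0 hfit0 hζ0 (hmem p) hdeep hne'
  -- an active cube at a deep point contains every point of `Ω₀` within torus distance `< R` of it
  have memα : ∀ (α : ↥(labels (P.L ^ k) M0 s)) (p : Balaban1983to89.Site P 0), p ∈ Ω₀ →
      (∀ i, R₀ ≤ (boxCoord hPd (P.L ^ k) c p i : ℝ) ∧ (boxCoord hPd (P.L ^ k) c p i : ℝ) + R₀ ≤ (P.L ^ k * M0 i : ℕ) - 1) →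
      (∃ y, ζ p y * lamFam hPd (P.L ^ k) c M0 s α p y ≠ 0) →
      ∀ q ∈ Ω₀, B5Ineq137Torus.T P 0 p q < R → q ∈ cubeFam hPd (P.L ^ k) c M0 s W α := by
    intro α p hp hdeep hex q hq hlt
    obtain ⟨y₀, hy₀⟩ := hex
    obtain ⟨-, -, hfar⟩ := rowHyp_ii hPd hn hs0 hfit0 hR0 hgap hW hζ0 hp hdeep α y₀ hy₀
    by_contra hnot
    exact absurd (hfar q hq hnot).1 (not_le.2 hlt)
  -- … and every point at chart depth `≥ L^k` within `T12 + 2` of it is `L^k`-deep in the cube (p34's row condition)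
  have depthα : ∀ (α : ↥(labels (P.L ^ k) M0 s)) (p : Balaban1983to89.Site P 0), p ∈ Ω₀ →
      (∀ i, R₀ ≤ (boxCoord hPd (P.L ^ k) c p i : ℝ) ∧ (boxCoord hPd (P.L ^ k) c p i : ℝ) + R₀ ≤ (P.L ^ k * M0 i : ℕ) - 1) →
      (∃ y, ζ p y * lamFam hPd (P.L ^ k) c M0 s α p y ≠ 0) →
      ∀ q : Balaban1983to89.Site P 0,
        (∀ i, (P.L : ℝ) ^ k ≤ (boxCoord hPd (P.L ^ k) c q i : ℝ) ∧ (boxCoord hPd (P.L ^ k) c q i : ℝ) + (P.L : ℝ) ^ k ≤ (P.L ^ k * M0 i : ℕ) - 1) →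
        B5Ineq137Torus.T P 0 p q ≤ T12 + 2 → ∀ v, v ∉ cubeFam hPd (P.L ^ k) c M0 s W α → P.L ^ k ≤ supDist q v := by
    intro α p hp hdeep hex q hdeepq hpq v hv
    obtain ⟨y₀, hy₀⟩ := hex
    obtain ⟨-, -, hfar⟩ := rowHyp_ii hPd hn hs0 hfit0 hR0 hgap hW hζ0 hp hdeep α y₀ hy₀
    have hTqv : (P.L : ℝ) ^ k ≤ B5Ineq137Torus.T P 0 q v := by
      by_cases hvΩ : v ∈ Ω₀
      · have h1 := (hfar v hvΩ hv).1
        have h2 := B5Ineq137Torus.T_triangle P 0 p q v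
        linarith only [h1, h2, hpq, hnear, hR, hLk1]
      · by_contra hlt
        push Not at hlt
        exact hvΩ (mem_and_abs_sub_le_of_T_le hPd hfit0 hdeepq hlt.le).1
    rw [T_eq_supDist P q v] at hTqv
    exact_mod_cast hTqv
  -- the `3L^k`-balls around `x₁`, `x₂` lie in every cube active at `x₂'`
  have ballα : ∀ (α : ↥(labels (P.L ^ k) M0 s)), (∃ y, ζ x₂' y * lamFam hPd (P.L ^ k) c M0 s α x₂' y ≠ 0) →
      (∀ y, B5Ineq137Torus.T P 0 x₁ y < 3 * (P.L : ℝ) ^ k → y ∈ cubeFam hPd (P.L ^ k) c M0 s W α) ∧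
      (∀ y, B5Ineq137Torus.T P 0 x₂ y < 3 * (P.L : ℝ) ^ k → y ∈ cubeFam hPd (P.L ^ k) c M0 s W α) := by
    intro α hex
    constructor
    · intro y hy
      have hyΩ : y ∈ Ω₀ := (mem_and_abs_sub_le_of_T_le hPd hfit0 hdeep₁ (hy.le.trans hLR₀)).1
      refine memα α x₂' hx₂e hdeep₂e hex y hyΩ ?_
      have h1 := B5Ineq137Torus.T_triangle P 0 x₂' x₁ y
      linarith only [h1, hT2'1, hy, hnear, hR]
    · intro y hy
      have hyΩ : y ∈ Ω₀ := (mem_and_abs_sub_le_of_T_le hPd hfit0 hdeep₂ (hy.le.trans hLR₀)).1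
      refine memα α x₂' hx₂e hdeep₂e hex y hyΩ ?_
      have h1 := B5Ineq137Torus.T_triangle P 0 x₂' x₂ y
      linarith only [h1, hT2'2, hy, hnear, hR, hLk]
  -- the row sources and their vanishing
  set gs : Balaban1983to89.Site P 0 → ↥(labels (P.L ^ k) M0 s) → Balaban1983to89.Site P 0 → ℂ :=
    fun p α y => (ζ p y : ℂ) * (lamFam hPd (P.L ^ k) c M0 s α p y : ℂ) * f y with hgsdef
  set ds : Balaban1983to89.Site P 0 → Balaban1983to89.Site P 0 → ↥(labels (P.L ^ k) M0 s) → Balaban1983to89.Site P 0 → ℂ :=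
    fun p p' α y => ((ζ p' y : ℂ) * (lamFam hPd (P.L ^ k) c M0 s α p' y : ℂ) - (ζ p y : ℂ) * (lamFam hPd (P.L ^ k) c M0 s α p y : ℂ)) * f y
    with hdsdef
  have hgs0 : ∀ (p : Balaban1983to89.Site P 0) (α : ↥(labels (P.L ^ k) M0 s)),
      (¬∃ y, ζ p y * lamFam hPd (P.L ^ k) c M0 s α p y ≠ 0) → gs p α = 0 := by
    intro p α hex
    push Not at hex
    funext y; rw [hgsdef]; dsimp only; rw [← Complex.ofReal_mul, hex y, Complex.ofReal_zero, zero_mul]; rfl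
  have hds0 : ∀ (p p' : Balaban1983to89.Site P 0) (α : ↥(labels (P.L ^ k) M0 s)),
      (¬∃ y, ζ p' y * lamFam hPd (P.L ^ k) c M0 s α p' y ≠ 0) → (¬∃ y, ζ p y * lamFam hPd (P.L ^ k) c M0 s α p y ≠ 0) → ds p p' α = 0 := by
    intro p p' α hex' hex
    push Not at hex hex'
    funext y; rw [hdsdef]; dsimp only; rw [← Complex.ofReal_mul, ← Complex.ofReal_mul, hex y, hex' y]; simp
  have hgs_le : ∀ p α y, ‖gs p α y‖ ≤ F := fun p α y =>
    norm_rowSource_le (hζabs p y) (abs_lam_le_one (sum_abs_lamT_le_one hfit0) α p y) hF y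
  have hgs_supp : ∀ p α y, gs p α y ≠ 0 → f y ≠ 0 := fun p α y hy => (rowSource_ne_zero hy).2
  have hds_supp : ∀ p p' α y, ds p p' α y ≠ 0 → f y ≠ 0 := fun p p' α y hy => right_ne_zero_of_mul hy
  -- the bond identity at both bonds
  have hid₁ : covD P.eps⁻¹ (cfg U) (gLocT A P.eps⁻¹ U k (cubeFam hPd (P.L ^ k) c M0 s W) (lamFam hPd (P.L ^ k) c M0 s) ζ *ᵥ f) ⟨x₁, μ⟩ =
      ∑ α, covD P.eps⁻¹ (cfg U) (gBox A P.eps⁻¹ U k (cubeFam hPd (P.L ^ k) c M0 s W α) *ᵥ gs x₁' α) ⟨x₁, μ⟩ +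
      ∑ α, ((P.eps⁻¹ : ℝ) : ℂ) * (gBox A P.eps⁻¹ U k (cubeFam hPd (P.L ^ k) c M0 s W α) *ᵥ ds x₁ x₁' α) x₁ :=
    covD_gLocT_apply P.eps⁻¹ (cfg U) A P.eps⁻¹ U k (cubeFam hPd (P.L ^ k) c M0 s W) (lamFam hPd (P.L ^ k) c M0 s) ζ f ⟨x₁, μ⟩
  have hid₂ : covD P.eps⁻¹ (cfg U) (gLocT A P.eps⁻¹ U k (cubeFam hPd (P.L ^ k) c M0 s W) (lamFam hPd (P.L ^ k) c M0 s) ζ *ᵥ f) ⟨x₂, μ⟩ =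
      ∑ α, covD P.eps⁻¹ (cfg U) (gBox A P.eps⁻¹ U k (cubeFam hPd (P.L ^ k) c M0 s W α) *ᵥ gs x₂' α) ⟨x₂, μ⟩ +
      ∑ α, ((P.eps⁻¹ : ℝ) : ℂ) * (gBox A P.eps⁻¹ U k (cubeFam hPd (P.L ^ k) c M0 s W α) *ᵥ ds x₂ x₂' α) x₂ :=
    covD_gLocT_apply P.eps⁻¹ (cfg U) A P.eps⁻¹ U k (cubeFam hPd (P.L ^ k) c M0 s W) (lamFam hPd (P.L ^ k) c M0 s) ζ f ⟨x₂, μ⟩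
  rw [hid₁, hid₂]
  -- the four families of summands
  set τ : ℂ := stairHol U x₁ x₂ with hτdef
  have hτ1 : ‖τ‖ = 1 := norm_stairHol U x₁ x₂
  set Ec : ℂ := ((P.eps⁻¹ : ℝ) : ℂ) with hEcdef
  have hEc : ‖Ec‖ = P.eps⁻¹ := by rw [hEcdef, Complex.norm_real, Real.norm_eq_abs, abs_of_pos (inv_pos.mpr heps)]
  set G : ↥(labels (P.L ^ k) M0 s) → Matrix (Balaban1983to89.Site P 0) (Balaban1983to89.Site P 0) ℂ :=
    fun α => gBox A P.eps⁻¹ U k (cubeFam hPd (P.L ^ k) c M0 s W α) with hGdef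
  set sA : ↥(labels (P.L ^ k) M0 s) → ℂ :=
    fun α => τ * covD P.eps⁻¹ (cfg U) (G α *ᵥ gs x₂' α) ⟨x₂, μ⟩ - covD P.eps⁻¹ (cfg U) (G α *ᵥ gs x₂' α) ⟨x₁, μ⟩ with hsAdef
  set sB : ↥(labels (P.L ^ k) M0 s) → ℂ :=
    fun α => covD P.eps⁻¹ (cfg U) (G α *ᵥ gs x₂' α) ⟨x₁, μ⟩ - covD P.eps⁻¹ (cfg U) (G α *ᵥ gs x₁' α) ⟨x₁, μ⟩ with hsBdef
  set sC : ↥(labels (P.L ^ k) M0 s) → ℂ :=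
    fun α => τ * (Ec * (G α *ᵥ ds x₂ x₂' α) x₂) - Ec * (G α *ᵥ ds x₂ x₂' α) x₁ with hsCdef
  set sD : ↥(labels (P.L ^ k) M0 s) → ℂ :=
    fun α => Ec * (G α *ᵥ ds x₂ x₂' α) x₁ - Ec * (G α *ᵥ ds x₁ x₁' α) x₁ with hsDdef
  have hdecomp : τ * (∑ α, covD P.eps⁻¹ (cfg U) (G α *ᵥ gs x₂' α) ⟨x₂, μ⟩ + ∑ α, Ec * (G α *ᵥ ds x₂ x₂' α) x₂) -
      (∑ α, covD P.eps⁻¹ (cfg U) (G α *ᵥ gs x₁' α) ⟨x₁, μ⟩ + ∑ α, Ec * (G α *ᵥ ds x₁ x₁' α) x₁) =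
      (∑ α, sA α + ∑ α, sB α) + (∑ α, sC α + ∑ α, sD α) := by
    simp only [hsAdef, hsBdef, hsCdef, hsDdef, hGdef, Finset.sum_sub_distrib, mul_add, Finset.mul_sum]
    ring
  /- TERM A: [6] (1.9) for each cube active at `x₂'`, fixed source (p34's LOCAL gauge-free cube input (B-II), transport `stairHol`) -/
  set BA : ℝ := P.spacing k * (cH * Real.exp (-(δH * (((P.L : ℝ) ^ k)⁻¹ * D))) * F) with hBAdef
  have hBA0 : 0 ≤ BA := by rw [hBAdef]; positivity
  have hsA0 : ∀ α, gs x₂' α = 0 → sA α = 0 := fun α h0 => by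
    simp only [hsAdef]; rw [h0, mulVec_zero, covD_zero, covD_zero, mul_zero, sub_zero]
  have htermA : ∀ α, w * ‖sA α‖ ≤ BA := by
    intro α
    by_cases hex : ∃ y, ζ x₂' y * lamFam hPd (P.L ^ k) c M0 s α x₂' y ≠ 0
    · obtain ⟨hb₁, hb₂⟩ := ballα α hex
      exact HH P hPd hPL k hk1 hkK hRsz (cubeFam hPd (P.L ^ k) c M0 s W α) (hcubeBU α) U θp hθp0 (hplaqα α) hθps T hT hsmallT μ x₁ x₂
        hne hb₁ hb₂ (gs x₂' α) F D (hgs_le x₂' α) (fun y hy => hsupp₁ y (hgs_supp x₂' α y hy))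
        (fun y hy => hsupp₂ y (hgs_supp x₂' α y hy))
    · rw [hsA0 α (hgs0 x₂' α hex), norm_zero, mul_zero]; exact hBA0
  have hzeroA : ∀ α, α ∉ S x₂' → sA α = 0 := fun α hα =>
    hsA0 α (hgs0 x₂' α fun ⟨y, hy⟩ => hα (hS x₂' hdeep₂e α y hy))
  have hsumA : w * ‖∑ α, sA α‖ ≤ m * BA := by
    rw [← Finset.sum_subset (Finset.subset_univ (S x₂')) (fun α _ hα => hzeroA α hα)]
    calc w * ‖∑ α ∈ S x₂', sA α‖ ≤ w * ∑ α ∈ S x₂', ‖sA α‖ := mul_le_mul_of_nonneg_left (norm_sum_le _ _) hw0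
      _ = ∑ α ∈ S x₂', w * ‖sA α‖ := Finset.mul_sum _ _ _
      _ ≤ ∑ α ∈ S x₂', BA := Finset.sum_le_sum fun α _ => htermA α
      _ = (S x₂').card * BA := by rw [Finset.sum_const, nsmul_eq_mul]
      _ ≤ m * BA := mul_le_mul_of_nonneg_right (hcard x₂') hBA0
  /- TERM B: p34's LOCAL (1.10) derivative member (B-II) on the difference of the row sources of `x₂'` and `x₁'` -/
  set Λ₁ : ℝ := K₁ / (R₀ - R₁) + 3 * Real.pi * (d + 1 : ℕ) / (2 * s) with hΛ₁def
  have hΛ₁0 : 0 ≤ Λ₁ := by rw [hΛ₁def]; positivity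
  set dB : ↥(labels (P.L ^ k) M0 s) → Balaban1983to89.Site P 0 → ℂ := fun α y =>
    ((ζ x₂' y * lamFam hPd (P.L ^ k) c M0 s α x₂' y - ζ x₁' y * lamFam hPd (P.L ^ k) c M0 s α x₁' y : ℝ) : ℂ) * f y with hdBdef
  have hdB : ∀ α, gs x₂' α - gs x₁' α = dB α := fun α => by
    funext y; simp only [hgsdef, hdBdef, Pi.sub_apply]; push_cast; ring
  have hsB_eq : ∀ α, sB α = covD P.eps⁻¹ (cfg U) (G α *ᵥ dB α) ⟨x₁, μ⟩ := fun α => by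
    simp only [hsBdef]; rw [covD_mulVec_sub, hdB]
  have hdB_le : ∀ α y, ‖dB α y‖ ≤ Λ₁ * (((d : ℝ) + 1) * T12) * F := by
    intro α y
    have h1 := abs_weight_shift_sub_le_of_hull (hPd := hPd) (c := c) hs0 hfit0 hN0 hK₁' hζabs hζ1 α.1 hz₁ hz₂ hroom₁ hroom₂ μ y
    rw [hxz₁, hxz₂] at h1
    simp only [hdBdef]
    rw [norm_mul, Complex.norm_real, Real.norm_eq_abs]
    refine mul_le_mul (h1.trans ?_) (hF y) (norm_nonneg _) (by positivity)
    exact mul_le_mul_of_nonneg_left hl1 hΛ₁0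
  have hdB_supp : ∀ α y, dB α y ≠ 0 → f y ≠ 0 := fun α y hy => right_ne_zero_of_mul hy
  -- the chart depth `≥ L^k` of `x₁`
  have hdeepL : ∀ (q : Balaban1983to89.Site P 0),
      (∀ i, R₀ ≤ (boxCoord hPd (P.L ^ k) c q i : ℝ) ∧ (boxCoord hPd (P.L ^ k) c q i : ℝ) + R₀ ≤ (P.L ^ k * M0 i : ℕ) - 1) →
      ∀ i, (P.L : ℝ) ^ k ≤ (boxCoord hPd (P.L ^ k) c q i : ℝ) ∧ (boxCoord hPd (P.L ^ k) c q i : ℝ) + (P.L : ℝ) ^ k ≤ (P.L ^ k * M0 i : ℕ) - 1 :=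
    fun q hq i => ⟨hLR₀'.trans (hq i).1, by linarith only [(hq i).2, hLR₀']⟩
  set BB : ℝ := c₁ * P.spacing k * Real.exp (-(δ₁ * D / (P.L : ℝ) ^ k)) * (Λ₁ * (((d : ℝ) + 1) * T12) * F) with hBBdef
  have hBB0 : 0 ≤ BB := by rw [hBBdef]; positivity
  have htermB : ∀ α, ‖sB α‖ ≤ BB := by
    intro α
    by_cases hex : (∃ y, ζ x₂' y * lamFam hPd (P.L ^ k) c M0 s α x₂' y ≠ 0) ∨ (∃ y, ζ x₁' y * lamFam hPd (P.L ^ k) c M0 s α x₁' y ≠ 0)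
    · have hdepth : ∀ v, v ∉ cubeFam hPd (P.L ^ k) c M0 s W α → P.L ^ k ≤ supDist x₁ v := by
        rcases hex with hex | hex
        · exact depthα α x₂' hx₂e hdeep₂e hex x₁ (hdeepL x₁ hdeep₁) (by linarith only [hT2'1])
        · exact depthα α x₁' hx₁e hdeep₁e hex x₁ (hdeepL x₁ hdeep₁) (by linarith only [hT1'1, hT0])
      have key := H1 P hPd hPL k hk1 hkK hRsz (cubeFam hPd (P.L ^ k) c M0 s W α) (hcubeBU α) U θp hθp0 (hplaqα α) hθps T hT hsmallT
        x₁ μ (dB α) (Λ₁ * (((d : ℝ) + 1) * T12) * F) D (hdB_le α) (hsuppN x₁ (dB α) D fun y hy => hsupp₁ y (hdB_supp α y hy)) hdepth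
      rw [hsB_eq α]; exact key
    · push Not at hex
      simp only [hsBdef]
      rw [hgs0 x₂' α (not_exists.2 fun y hy => hy (hex.1 y)), hgs0 x₁' α (not_exists.2 fun y hy => hy (hex.2 y))]
      simp only [mulVec_zero, covD_zero, sub_self, norm_zero]
      exact hBB0
  have hzeroB : ∀ α, α ∉ S x₂' ∪ S x₁' → sB α = 0 := by
    intro α hα
    rw [Finset.mem_union, not_or] at hα
    simp only [hsBdef]
    rw [hgs0 x₂' α fun ⟨y, hy⟩ => hα.1 (hS x₂' hdeep₂e α y hy), hgs0 x₁' α fun ⟨y, hy⟩ => hα.2 (hS x₁' hdeep₁e α y hy)]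
    simp only [mulVec_zero, covD_zero, sub_self]
  have hsumB : ‖∑ α, sB α‖ ≤ 2 * m * BB := by
    rw [← Finset.sum_subset (Finset.subset_univ (S x₂' ∪ S x₁')) (fun α _ hα => hzeroB α hα)]
    have hcardU : (((S x₂' ∪ S x₁').card : ℕ) : ℝ) ≤ 2 * m := by
      have h1 : (((S x₂' ∪ S x₁').card : ℕ) : ℝ) ≤ ((S x₂').card : ℝ) + ((S x₁').card : ℝ) := by
        exact_mod_cast Finset.card_union_le _ _
      linarith only [h1, hcard x₂', hcard x₁']
    calc ‖∑ α ∈ S x₂' ∪ S x₁', sB α‖ ≤ ∑ α ∈ S x₂' ∪ S x₁', ‖sB α‖ := norm_sum_le _ _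
      _ ≤ ∑ α ∈ S x₂' ∪ S x₁', BB := Finset.sum_le_sum fun α _ => htermB α
      _ = (S x₂' ∪ S x₁').card * BB := by rw [Finset.sum_const, nsmul_eq_mul]
      _ ≤ 2 * m * BB := mul_le_mul_of_nonneg_right hcardU hBB0
  /- TERM C: the transported difference of the values of `G_α(Δ_μ-source of x₂)` between `x₁` and `x₂`, telescoped along the staircase -/
  have hds_le : ∀ α y, ‖ds x₂ x₂' α y‖ ≤ Λ₁ * F := fun α y =>
    norm_rowSource_sub_le_of_lipschitz hPd hs0 hfit0 hN0 hK₁' hζabs (fun y => hζ1 x₂ y μ) α.1 hx₂ hx₂e hF y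
  set BC : ℝ := c₁ * P.spacing k * Real.exp (-(δ₁ * D' / (P.L : ℝ) ^ k)) * (Λ₁ * F) with hBCdef
  have hBC0 : 0 ≤ BC := by rw [hBCdef]; positivity
  -- the staircase sites: within `T12` of `x₁` and of `x₂`, hence in `Ω₀` at chart depth `≥ R₀ − T12 ≥ L^k`
  have hdeep₂T : ∀ i, T12 ≤ (z₂ i : ℝ) ∧ (z₂ i : ℝ) + T12 ≤ (P.L ^ k * M0 i : ℕ) - 1 := fun i => by
    have h1 := hdeep₂ i
    constructor <;> linarith only [h1.1, h1.2, hnear, hLR₀']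
  have stairDeep : ∀ w : Balaban1983to89.Site P 0, supDist x₂ w ≤ supDist x₁ x₂ →
      (∀ i, (P.L : ℝ) ^ k ≤ (boxCoord hPd (P.L ^ k) c w i : ℝ) ∧ (boxCoord hPd (P.L ^ k) c w i : ℝ) + (P.L : ℝ) ^ k ≤ (P.L ^ k * M0 i : ℕ) - 1) ∧
      B5Ineq137Torus.T P 0 x₂ w ≤ T12 := by
    intro w hw
    have hTw : B5Ineq137Torus.T P 0 x₂ w ≤ T12 := by
      rw [T_eq_supDist P x₂ w, hT12N]; exact_mod_cast hw
    obtain ⟨-, hcoord⟩ := mem_and_abs_sub_le_of_T_le hPd hfit0 hdeep₂T hTw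
    refine ⟨fun i => ?_, hTw⟩
    have h1 := hcoord i
    have h2 := hdeep₂ i
    have h3 : ((|z₂ i - boxCoord hPd (P.L ^ k) c w i| : ℤ) : ℝ) = |((z₂ i : ℤ) : ℝ) - (boxCoord hPd (P.L ^ k) c w i : ℝ)| := by push_cast; rfl
    rw [h3, abs_le] at h1
    constructor <;> linarith only [h1.1, h1.2, h2.1, h2.2, hnear, hLR₀]
  have htermC : ∀ α, ‖sC α‖ ≤ BC * (((d : ℝ) + 1) * T12) := by
    intro α
    by_cases hex : (∃ y, ζ x₂' y * lamFam hPd (P.L ^ k) c M0 s α x₂' y ≠ 0) ∨ (∃ y, ζ x₂ y * lamFam hPd (P.L ^ k) c M0 s α x₂ y ≠ 0)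
    · -- the bond bound along the staircase
      have hbond : ∀ (w' : Balaban1983to89.Site P 0) (m' : Fin P.d), supDist x₁ w' ≤ supDist x₁ x₂ → supDist x₂ w' ≤ supDist x₁ x₂ →
          ‖covD P.eps⁻¹ (cfg U) (G α *ᵥ ds x₂ x₂' α) ⟨w', m'⟩‖ ≤ BC := by
        intro w' m' hw1 hw2
        obtain ⟨hdeepw, hTw⟩ := stairDeep w' hw2
        have hdepth : ∀ v, v ∉ cubeFam hPd (P.L ^ k) c M0 s W α → P.L ^ k ≤ supDist w' v := by
          rcases hex with hex | hex
          · refine depthα α x₂' hx₂e hdeep₂e hex w' hdeepw ?_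
            have h1 := B5Ineq137Torus.T_triangle P 0 x₂' x₂ w'; linarith only [h1, hT2'2, hTw]
          · exact depthα α x₂ hx₂ hdeep₂ hex w' hdeepw (by linarith only [hTw])
        have hsuppw : ∀ y, ds x₂ x₂' α y ≠ 0 → D' ≤ B5Ineq137Torus.T P 0 w' y := by
          intro y hy
          refine max_le ?_ (B5Ineq137Torus.T_nonneg P 0 _ y)
          have h1 := hsupp₁ y (hds_supp x₂ x₂' α y hy)
          have h2 := B5Ineq137Torus.T_triangle P 0 x₁ w' y
          have h3 : B5Ineq137Torus.T P 0 x₁ w' ≤ T12 := by rw [T_eq_supDist P x₁ w', hT12N]; exact_mod_cast hw1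
          linarith only [h1, h2, h3]
        exact H1 P hPd hPL k hk1 hkK hRsz (cubeFam hPd (P.L ^ k) c M0 s W α) (hcubeBU α) U θp hθp0 (hplaqα α) hθps T hT hsmallT
          w' m' (ds x₂ x₂' α) (Λ₁ * F) D' (hds_le α) (hsuppN w' (ds x₂ x₂' α) D' hsuppw) hdepth
      have htel := norm_stairHol_mul_sub_le_of_near U (inv_ne_zero heps.ne') (G α *ᵥ ds x₂ x₂' α) x₁ x₂ hBC0 hbond
      rw [abs_inv, abs_of_pos heps, inv_inv, ← hT12N, hPdR] at htel
      have e : sC α = Ec * (τ * (G α *ᵥ ds x₂ x₂' α) x₂ - (G α *ᵥ ds x₂ x₂' α) x₁) := by simp only [hsCdef]; ring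
      rw [e, norm_mul, hEc, hτdef]
      calc P.eps⁻¹ * ‖stairHol U x₁ x₂ * (G α *ᵥ ds x₂ x₂' α) x₂ - (G α *ᵥ ds x₂ x₂' α) x₁‖
          ≤ P.eps⁻¹ * (P.eps * BC * (((d : ℝ) + 1) * T12)) := mul_le_mul_of_nonneg_left htel (inv_pos.mpr heps).le
        _ = BC * (((d : ℝ) + 1) * T12) := by rw [← mul_assoc, ← mul_assoc P.eps⁻¹, inv_mul_cancel₀ heps.ne', one_mul]
    · push Not at hex
      simp only [hsCdef]
      rw [hds0 x₂ x₂' α (not_exists.2 fun y hy => hy (hex.1 y)) (not_exists.2 fun y hy => hy (hex.2 y))]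
      simp only [mulVec_zero, Pi.zero_apply, mul_zero, sub_zero, norm_zero]
      positivity
  have hzeroC : ∀ α, α ∉ S x₂' ∪ S x₂ → sC α = 0 := by
    intro α hα
    rw [Finset.mem_union, not_or] at hα
    simp only [hsCdef]
    rw [hds0 x₂ x₂' α (fun ⟨y, hy⟩ => hα.1 (hS x₂' hdeep₂e α y hy)) (fun ⟨y, hy⟩ => hα.2 (hS x₂ hdeep₂ α y hy))]
    simp only [mulVec_zero, Pi.zero_apply, mul_zero, sub_zero]
  have hsumC : ‖∑ α, sC α‖ ≤ 2 * m * (BC * (((d : ℝ) + 1) * T12)) := by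
    rw [← Finset.sum_subset (Finset.subset_univ (S x₂' ∪ S x₂)) (fun α _ hα => hzeroC α hα)]
    have hcardU : (((S x₂' ∪ S x₂).card : ℕ) : ℝ) ≤ 2 * m := by
      have h1 : (((S x₂' ∪ S x₂).card : ℕ) : ℝ) ≤ ((S x₂').card : ℝ) + ((S x₂).card : ℝ) := by
        exact_mod_cast Finset.card_union_le _ _
      linarith only [h1, hcard x₂', hcard x₂]
    calc ‖∑ α ∈ S x₂' ∪ S x₂, sC α‖ ≤ ∑ α ∈ S x₂' ∪ S x₂, ‖sC α‖ := norm_sum_le _ _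
      _ ≤ ∑ α ∈ S x₂' ∪ S x₂, BC * (((d : ℝ) + 1) * T12) := Finset.sum_le_sum fun α _ => htermC α
      _ = (S x₂' ∪ S x₂).card * (BC * (((d : ℝ) + 1) * T12)) := by rw [Finset.sum_const, nsmul_eq_mul]
      _ ≤ 2 * m * (BC * (((d : ℝ) + 1) * T12)) := mul_le_mul_of_nonneg_right hcardU (by positivity)
  /- TERM D: p34's LOCAL (1.10) value member (B-I) on the difference of the bond-difference sources of `x₂` and `x₁` -/
  set Λ₂ : ℝ := K₂ / (R₀ - R₁) ^ 2 + 4 * Real.pi ^ 2 / (s : ℝ) ^ 2 + 2 * (K₁ / (R₀ - R₁) * (3 * Real.pi * (d + 1 : ℕ) / (2 * s)))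
    with hΛ₂def
  have hΛ₂0 : 0 ≤ Λ₂ := by rw [hΛ₂def]; positivity
  set dD : ↥(labels (P.L ^ k) M0 s) → Balaban1983to89.Site P 0 → ℂ := fun α y =>
    (((ζ x₂' y * lamFam hPd (P.L ^ k) c M0 s α x₂' y - ζ x₂ y * lamFam hPd (P.L ^ k) c M0 s α x₂ y) -
        (ζ x₁' y * lamFam hPd (P.L ^ k) c M0 s α x₁' y - ζ x₁ y * lamFam hPd (P.L ^ k) c M0 s α x₁ y) : ℝ) : ℂ) * f y with hdDdef
  have hdD : ∀ α, ds x₂ x₂' α - ds x₁ x₁' α = dD α := fun α => by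
    funext y; simp only [hdsdef, hdDdef, Pi.sub_apply]; push_cast; ring
  have hdD' : ∀ α, G α *ᵥ ds x₂ x₂' α - G α *ᵥ ds x₁ x₁' α = G α *ᵥ dD α := fun α => by rw [← Matrix.mulVec_sub, hdD]
  have hsD_eq : ∀ α, sD α = Ec * (G α *ᵥ dD α) x₁ := fun α => by
    simp only [hsDdef]; rw [← mul_sub, ← hdD', Pi.sub_apply]
  have hdD_le : ∀ α y, ‖dD α y‖ ≤ Λ₂ * (((d : ℝ) + 1) * T12) * F := by
    intro α y
    have h1 := abs_weight_bondDiff_sub_le_of_hull (hPd := hPd) (c := c) hs0 hfit0 hN0 hζabs hζ1 hζ2 α.1 hz₁ hz₂ hroom₁ hroom₂ μ y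
    rw [hxz₁, hxz₂] at h1
    simp only [hdDdef]
    rw [norm_mul, Complex.norm_real, Real.norm_eq_abs]
    refine mul_le_mul (h1.trans ?_) (hF y) (norm_nonneg _) (by positivity)
    exact mul_le_mul_of_nonneg_left hl1 hΛ₂0
  have hdD_supp : ∀ α y, dD α y ≠ 0 → f y ≠ 0 := fun α y hy => right_ne_zero_of_mul hy
  set BD : ℝ := c₂ * P.spacing k ^ 2 * Real.exp (-(δ₂ * D / (P.L : ℝ) ^ k)) * (Λ₂ * (((d : ℝ) + 1) * T12) * F) with hBDdef
  have hBD0 : 0 ≤ BD := by rw [hBDdef]; positivity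
  have htermD : ∀ α, ‖sD α‖ ≤ P.eps⁻¹ * BD := by
    intro α
    have key := H2 P hPd hPL' k hk1 hkmK hRsz (cubeFam hPd (P.L ^ k) c M0 s W α) (hcubeBU α) U θp hθp0 (hplaqα α) T hT hsmallT x₁ (dD α)
      (Λ₂ * (((d : ℝ) + 1) * T12) * F) D (hdD_le α) (fun y hy => hsupp₁ y (hdD_supp α y hy))
    rw [hsD_eq α, norm_mul, hEc]
    refine mul_le_mul_of_nonneg_left (key.trans (le_of_eq ?_)) (inv_pos.mpr heps).le
    rw [hBDdef, show δ₂ * D / (P.L : ℝ) ^ k = δ₂ * (((P.L : ℝ) ^ k)⁻¹ * D) from by ring]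
    ring
  have hzeroD : ∀ α, α ∉ (S x₂' ∪ S x₂) ∪ (S x₁' ∪ S x₁) → sD α = 0 := by
    intro α hα
    simp only [Finset.mem_union, not_or] at hα
    simp only [hsDdef]
    rw [hds0 x₂ x₂' α (fun ⟨y, hy⟩ => hα.1.1 (hS x₂' hdeep₂e α y hy)) (fun ⟨y, hy⟩ => hα.1.2 (hS x₂ hdeep₂ α y hy)),
      hds0 x₁ x₁' α (fun ⟨y, hy⟩ => hα.2.1 (hS x₁' hdeep₁e α y hy)) (fun ⟨y, hy⟩ => hα.2.2 (hS x₁ hdeep₁ α y hy))]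
    simp only [mulVec_zero, Pi.zero_apply, mul_zero, sub_self]
  have hsumD : ‖∑ α, sD α‖ ≤ 4 * m * (P.eps⁻¹ * BD) := by
    rw [← Finset.sum_subset (Finset.subset_univ ((S x₂' ∪ S x₂) ∪ (S x₁' ∪ S x₁))) (fun α _ hα => hzeroD α hα)]
    have hcardU : (((((S x₂' ∪ S x₂) ∪ (S x₁' ∪ S x₁)).card : ℕ)) : ℝ) ≤ 4 * m := by
      have h1 : ((((S x₂' ∪ S x₂) ∪ (S x₁' ∪ S x₁)).card : ℕ) : ℝ) ≤ (((S x₂' ∪ S x₂).card : ℕ) : ℝ) + (((S x₁' ∪ S x₁).card : ℕ) : ℝ) := by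
        exact_mod_cast Finset.card_union_le _ _
      have h2 : (((S x₂' ∪ S x₂).card : ℕ) : ℝ) ≤ ((S x₂').card : ℝ) + ((S x₂).card : ℝ) := by exact_mod_cast Finset.card_union_le _ _
      have h3 : (((S x₁' ∪ S x₁).card : ℕ) : ℝ) ≤ ((S x₁').card : ℝ) + ((S x₁).card : ℝ) := by exact_mod_cast Finset.card_union_le _ _
      linarith only [h1, h2, h3, hcard x₂', hcard x₂, hcard x₁', hcard x₁]
    calc ‖∑ α ∈ (S x₂' ∪ S x₂) ∪ (S x₁' ∪ S x₁), sD α‖ ≤ ∑ α ∈ (S x₂' ∪ S x₂) ∪ (S x₁' ∪ S x₁), ‖sD α‖ := norm_sum_le _ _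
      _ ≤ ∑ α ∈ (S x₂' ∪ S x₂) ∪ (S x₁' ∪ S x₁), P.eps⁻¹ * BD := Finset.sum_le_sum fun α _ => htermD α
      _ = ((S x₂' ∪ S x₂) ∪ (S x₁' ∪ S x₁)).card * (P.eps⁻¹ * BD) := by rw [Finset.sum_const, nsmul_eq_mul]
      _ ≤ 4 * m * (P.eps⁻¹ * BD) := mul_le_mul_of_nonneg_right hcardU (by positivity)
  /- ASSEMBLY -/
  have hscale : P.eps⁻¹ * P.spacing k ^ 2 = P.spacing k * (P.L : ℝ) ^ k := by
    rw [Params.spacing]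
    field_simp
  -- the Lipschitz moduli against the bracket: `L^k·Λ₁ ≤ Λ₀·br`, `(L^k)²·Λ₂ ≤ Λ₀₂·br²`
  have hΛ₁le : (P.L : ℝ) ^ k * Λ₁ ≤ Λ₀ * br := by
    have h1 : Λ₁ ≤ Λ₀ * uv := by
      rw [hΛ₁def, huvdef, mul_add]
      refine add_le_add ?_ ?_
      · rw [div_eq_mul_inv]
        exact mul_le_mul_of_nonneg_right (le_max_left _ _) (inv_pos.mpr hgap').le
      · have e : 3 * Real.pi * (d + 1 : ℕ) / (2 * s) = (3 * Real.pi * (d + 1 : ℕ) / 2) * (s : ℝ)⁻¹ := by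
          field_simp
        rw [e]
        exact mul_le_mul_of_nonneg_right (le_max_right _ _) (inv_pos.mpr hsr).le
    calc (P.L : ℝ) ^ k * Λ₁ ≤ (P.L : ℝ) ^ k * (Λ₀ * uv) := mul_le_mul_of_nonneg_left h1 hLk.le
      _ = Λ₀ * ((P.L : ℝ) ^ k * uv) := by ring
      _ ≤ Λ₀ * br := mul_le_mul_of_nonneg_left hLuv hΛ₀0
  have hΛ₂le : ((P.L : ℝ) ^ k) ^ 2 * Λ₂ ≤ Λ₀₂ * br ^ 2 := by
    have hu : 0 ≤ (R₀ - R₁)⁻¹ := (inv_pos.mpr hgap').le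
    have hv : 0 ≤ (s : ℝ)⁻¹ := (inv_pos.mpr hsr).le
    have h1 : Λ₂ ≤ Λ₀₂ * uv ^ 2 := by
      rw [hΛ₂def, hΛ₀₂def, huvdef]
      have e1 : K₂ / (R₀ - R₁) ^ 2 = K₂ * ((R₀ - R₁)⁻¹) ^ 2 := by rw [div_eq_mul_inv, inv_pow]
      have e2 : 4 * Real.pi ^ 2 / (s : ℝ) ^ 2 = 4 * Real.pi ^ 2 * ((s : ℝ)⁻¹) ^ 2 := by rw [div_eq_mul_inv, inv_pow]
      have e3 : 2 * (K₁ / (R₀ - R₁) * (3 * Real.pi * (d + 1 : ℕ) / (2 * s))) =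
          3 * Real.pi * (d + 1 : ℕ) * K₁ * ((R₀ - R₁)⁻¹ * (s : ℝ)⁻¹) := by
        rw [div_eq_mul_inv, div_eq_mul_inv, mul_inv]
        ring
      rw [e1, e2, e3]
      have hq1 : ((R₀ - R₁)⁻¹) ^ 2 ≤ ((R₀ - R₁)⁻¹ + (s : ℝ)⁻¹) ^ 2 := pow_le_pow_left₀ hu (le_add_of_nonneg_right hv) 2
      have hq2 : ((s : ℝ)⁻¹) ^ 2 ≤ ((R₀ - R₁)⁻¹ + (s : ℝ)⁻¹) ^ 2 := pow_le_pow_left₀ hv (le_add_of_nonneg_left hu) 2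
      have hq3 : (R₀ - R₁)⁻¹ * (s : ℝ)⁻¹ ≤ ((R₀ - R₁)⁻¹ + (s : ℝ)⁻¹) ^ 2 := by
        have e : ((R₀ - R₁)⁻¹ + (s : ℝ)⁻¹) ^ 2 =
            (R₀ - R₁)⁻¹ * (s : ℝ)⁻¹ + (((R₀ - R₁)⁻¹) ^ 2 + (R₀ - R₁)⁻¹ * (s : ℝ)⁻¹ + ((s : ℝ)⁻¹) ^ 2) := by ring
        rw [e]
        exact le_add_of_nonneg_right (by positivity)
      have hπ : 0 ≤ 4 * Real.pi ^ 2 := by positivity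
      have hπK : 0 ≤ 3 * Real.pi * (d + 1 : ℕ) * K₁ := by positivity
      calc K₂ * ((R₀ - R₁)⁻¹) ^ 2 + 4 * Real.pi ^ 2 * ((s : ℝ)⁻¹) ^ 2 + 3 * Real.pi * (d + 1 : ℕ) * K₁ * ((R₀ - R₁)⁻¹ * (s : ℝ)⁻¹)
          ≤ K₂ * ((R₀ - R₁)⁻¹ + (s : ℝ)⁻¹) ^ 2 + 4 * Real.pi ^ 2 * ((R₀ - R₁)⁻¹ + (s : ℝ)⁻¹) ^ 2 +
            3 * Real.pi * (d + 1 : ℕ) * K₁ * ((R₀ - R₁)⁻¹ + (s : ℝ)⁻¹) ^ 2 :=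
            add_le_add (add_le_add (mul_le_mul_of_nonneg_left hq1 hK₂) (mul_le_mul_of_nonneg_left hq2 hπ))
              (mul_le_mul_of_nonneg_left hq3 hπK)
        _ = (K₂ + 4 * Real.pi ^ 2 + 3 * Real.pi * (d + 1 : ℕ) * K₁) * ((R₀ - R₁)⁻¹ + (s : ℝ)⁻¹) ^ 2 := by ring
    calc ((P.L : ℝ) ^ k) ^ 2 * Λ₂ ≤ ((P.L : ℝ) ^ k) ^ 2 * (Λ₀₂ * uv ^ 2) := mul_le_mul_of_nonneg_left h1 (by positivity)
      _ = Λ₀₂ * ((P.L : ℝ) ^ k * uv) ^ 2 := by ring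
      _ ≤ Λ₀₂ * br ^ 2 := mul_le_mul_of_nonneg_left (pow_le_pow_left₀ (by positivity) hLuv 2) hΛ₀₂0
  -- the four terms in the common shape `spacing·(C_T·m·br²·Ex·F)`
  have hA : w * ‖∑ α, sA α‖ ≤ P.spacing k * (cH * m * br ^ 2 * Ex * F) := by
    refine hsumA.trans ?_
    rw [hBAdef]
    have h1 : cH * Real.exp (-(δH * (((P.L : ℝ) ^ k)⁻¹ * D))) * F ≤ cH * Ex * F :=
      mul_le_mul_of_nonneg_right (mul_le_mul_of_nonneg_left hEH hcH.le) hF0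
    have h2 : 1 ≤ br ^ 2 := hbr1.trans hbr2
    calc m * (P.spacing k * (cH * Real.exp (-(δH * (((P.L : ℝ) ^ k)⁻¹ * D))) * F)) ≤ m * (P.spacing k * (cH * Ex * F)) :=
          mul_le_mul_of_nonneg_left (mul_le_mul_of_nonneg_left h1 hsp0.le) hm0
      _ = P.spacing k * (cH * m * 1 * Ex * F) := by ring
      _ ≤ P.spacing k * (cH * m * br ^ 2 * Ex * F) := by
          refine mul_le_mul_of_nonneg_left ?_ hsp0.le
          exact mul_le_mul_of_nonneg_right (mul_le_mul_of_nonneg_right (mul_le_mul_of_nonneg_left h2 (by positivity)) hE0.le) hF0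
  have hB : w * ‖∑ α, sB α‖ ≤ P.spacing k * (CB * m * br ^ 2 * Ex * F) := by
    have h1 : w * ‖∑ α, sB α‖ ≤ w * (2 * m * BB) := mul_le_mul_of_nonneg_left hsumB hw0
    refine h1.trans ?_
    have e : w * (2 * m * BB) =
        (w * T12) * Λ₁ * (P.spacing k * (2 * ((d : ℝ) + 1) * c₁ * m * Real.exp (-(δ₁ * D / (P.L : ℝ) ^ k)) * F)) := by
      rw [hBBdef]; ring
    rw [e]
    have h2 : (w * T12) * Λ₁ ≤ Λ₀ * br :=
      le_trans (mul_le_mul_of_nonneg_right hwT hΛ₁0) hΛ₁le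
    have h3 : P.spacing k * (2 * ((d : ℝ) + 1) * c₁ * m * Real.exp (-(δ₁ * D / (P.L : ℝ) ^ k)) * F) ≤
        P.spacing k * (2 * ((d : ℝ) + 1) * c₁ * m * Ex * F) :=
      mul_le_mul_of_nonneg_left (mul_le_mul_of_nonneg_right (mul_le_mul_of_nonneg_left hE1 (by positivity)) hF0) hsp0.le
    calc (w * T12) * Λ₁ * (P.spacing k * (2 * ((d : ℝ) + 1) * c₁ * m * Real.exp (-(δ₁ * D / (P.L : ℝ) ^ k)) * F))
        ≤ (Λ₀ * br) * (P.spacing k * (2 * ((d : ℝ) + 1) * c₁ * m * Ex * F)) :=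
          mul_le_mul h2 h3 (by positivity) (by positivity)
      _ = P.spacing k * (CB * m * br * Ex * F) := by rw [hCBdef]; ring
      _ ≤ P.spacing k * (CB * m * br ^ 2 * Ex * F) := by
          refine mul_le_mul_of_nonneg_left ?_ hsp0.le
          exact mul_le_mul_of_nonneg_right (mul_le_mul_of_nonneg_right (mul_le_mul_of_nonneg_left hbr2 (mul_nonneg hCB0 hm0)) hE0.le) hF0
  have hC : w * ‖∑ α, sC α‖ ≤ P.spacing k * (CC * m * br ^ 2 * Ex * F) := by
    have h1 : w * ‖∑ α, sC α‖ ≤ w * (2 * m * (BC * (((d : ℝ) + 1) * T12))) := mul_le_mul_of_nonneg_left hsumC hw0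
    refine h1.trans ?_
    have e : w * (2 * m * (BC * (((d : ℝ) + 1) * T12))) =
        (w * T12) * Λ₁ * (P.spacing k * (2 * ((d : ℝ) + 1) * c₁ * m * Real.exp (-(δ₁ * D' / (P.L : ℝ) ^ k)) * F)) := by
      rw [hBCdef]; ring
    rw [e]
    have h2 : (w * T12) * Λ₁ ≤ Λ₀ * br :=
      le_trans (mul_le_mul_of_nonneg_right hwT hΛ₁0) hΛ₁le
    have h3 : P.spacing k * (2 * ((d : ℝ) + 1) * c₁ * m * Real.exp (-(δ₁ * D' / (P.L : ℝ) ^ k)) * F) ≤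
        P.spacing k * (2 * ((d : ℝ) + 1) * c₁ * m * (Real.exp δ₁ * Ex) * F) :=
      mul_le_mul_of_nonneg_left (mul_le_mul_of_nonneg_right (mul_le_mul_of_nonneg_left hexpD' (by positivity)) hF0) hsp0.le
    calc (w * T12) * Λ₁ * (P.spacing k * (2 * ((d : ℝ) + 1) * c₁ * m * Real.exp (-(δ₁ * D' / (P.L : ℝ) ^ k)) * F))
        ≤ (Λ₀ * br) * (P.spacing k * (2 * ((d : ℝ) + 1) * c₁ * m * (Real.exp δ₁ * Ex) * F)) :=
          mul_le_mul h2 h3 (by positivity) (by positivity)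
      _ = P.spacing k * (CC * m * br * Ex * F) := by rw [hCCdef]; ring
      _ ≤ P.spacing k * (CC * m * br ^ 2 * Ex * F) := by
          refine mul_le_mul_of_nonneg_left ?_ hsp0.le
          exact mul_le_mul_of_nonneg_right (mul_le_mul_of_nonneg_right (mul_le_mul_of_nonneg_left hbr2 (mul_nonneg hCC0 hm0)) hE0.le) hF0
  have hDt : w * ‖∑ α, sD α‖ ≤ P.spacing k * (CD * m * br ^ 2 * Ex * F) := by
    have h1 : w * ‖∑ α, sD α‖ ≤ w * (4 * m * (P.eps⁻¹ * BD)) := mul_le_mul_of_nonneg_left hsumD hw0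
    refine h1.trans ?_
    have e : w * (4 * m * (P.eps⁻¹ * BD)) =
        (w * T12) * ((P.eps⁻¹ * P.spacing k ^ 2) * (4 * ((d : ℝ) + 1) * c₂ * m * Λ₂ * Real.exp (-(δ₂ * D / (P.L : ℝ) ^ k)) * F)) := by
      rw [hBDdef]; ring
    rw [e, hscale]
    have e2 : (w * T12) * (P.spacing k * (P.L : ℝ) ^ k * (4 * ((d : ℝ) + 1) * c₂ * m * Λ₂ * Real.exp (-(δ₂ * D / (P.L : ℝ) ^ k)) * F)) =
        ((w * T12) * ((P.L : ℝ) ^ k * Λ₂)) * (P.spacing k * (4 * ((d : ℝ) + 1) * c₂ * m * Real.exp (-(δ₂ * D / (P.L : ℝ) ^ k)) * F)) := by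
      ring
    rw [e2]
    have h2 : (w * T12) * ((P.L : ℝ) ^ k * Λ₂) ≤ Λ₀₂ * br ^ 2 := by
      calc (w * T12) * ((P.L : ℝ) ^ k * Λ₂) ≤ (P.L : ℝ) ^ k * ((P.L : ℝ) ^ k * Λ₂) := mul_le_mul_of_nonneg_right hwT (by positivity)
        _ = ((P.L : ℝ) ^ k) ^ 2 * Λ₂ := by ring
        _ ≤ Λ₀₂ * br ^ 2 := hΛ₂le
    have h3 : P.spacing k * (4 * ((d : ℝ) + 1) * c₂ * m * Real.exp (-(δ₂ * D / (P.L : ℝ) ^ k)) * F) ≤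
        P.spacing k * (4 * ((d : ℝ) + 1) * c₂ * m * Ex * F) :=
      mul_le_mul_of_nonneg_left (mul_le_mul_of_nonneg_right (mul_le_mul_of_nonneg_left hE2 (by positivity)) hF0) hsp0.le
    calc ((w * T12) * ((P.L : ℝ) ^ k * Λ₂)) * (P.spacing k * (4 * ((d : ℝ) + 1) * c₂ * m * Real.exp (-(δ₂ * D / (P.L : ℝ) ^ k)) * F))
        ≤ (Λ₀₂ * br ^ 2) * (P.spacing k * (4 * ((d : ℝ) + 1) * c₂ * m * Ex * F)) :=
          mul_le_mul h2 h3 (by positivity) (by positivity)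
      _ = P.spacing k * (CD * m * br ^ 2 * Ex * F) := by rw [hCDdef]; ring
  -- conclusion
  have hsplit : ‖(∑ α, sA α + ∑ α, sB α) + (∑ α, sC α + ∑ α, sD α)‖ ≤
      ‖∑ α, sA α‖ + ‖∑ α, sB α‖ + (‖∑ α, sC α‖ + ‖∑ α, sD α‖) :=
    (norm_add_le _ _).trans (add_le_add (norm_add_le _ _) (norm_add_le _ _))
  have hCsum : cH + CB + CC + CD ≤ C := by rw [hCdef]; linarith only [hcg.le]
  calc w * ‖τ * (∑ α, covD P.eps⁻¹ (cfg U) (G α *ᵥ gs x₂' α) ⟨x₂, μ⟩ + ∑ α, Ec * (G α *ᵥ ds x₂ x₂' α) x₂) -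
        (∑ α, covD P.eps⁻¹ (cfg U) (G α *ᵥ gs x₁' α) ⟨x₁, μ⟩ + ∑ α, Ec * (G α *ᵥ ds x₁ x₁' α) x₁)‖
      = w * ‖(∑ α, sA α + ∑ α, sB α) + (∑ α, sC α + ∑ α, sD α)‖ := by rw [hdecomp]
    _ ≤ w * (‖∑ α, sA α‖ + ‖∑ α, sB α‖ + (‖∑ α, sC α‖ + ‖∑ α, sD α‖)) := mul_le_mul_of_nonneg_left hsplit hw0
    _ = w * ‖∑ α, sA α‖ + w * ‖∑ α, sB α‖ + (w * ‖∑ α, sC α‖ + w * ‖∑ α, sD α‖) := by ring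
    _ ≤ P.spacing k * (cH * m * br ^ 2 * Ex * F) + P.spacing k * (CB * m * br ^ 2 * Ex * F) +
          (P.spacing k * (CC * m * br ^ 2 * Ex * F) + P.spacing k * (CD * m * br ^ 2 * Ex * F)) :=
        add_le_add (add_le_add hA hB) (add_le_add hC hDt)
    _ = P.spacing k * ((cH + CB + CC + CD) * m * br ^ 2 * Ex * F) := by ring
    _ ≤ P.spacing k * (C * m * br ^ 2 * Ex * F) := by
        refine mul_le_mul_of_nonneg_left ?_ hsp0.le
        exact mul_le_mul_of_nonneg_right (mul_le_mul_of_nonneg_right (mul_le_mul_of_nonneg_right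
          (mul_le_mul_of_nonneg_right hCsum hm0) (by positivity)) hE0.le) hF0


end DerivHolder

/-! ## §3 The member for r18's smooth product cut-off `ζ″ = ζ^Π(R₁, R₀)` of (2.29), and under the printed (2.32) near `Ω₀` -/

section ZetaPiMember

open BIJ88LocDeriv230ZetaPiFlatTorus (zetaPi_zero_eq_zero_of_le abs_zetaPi_zero_le_one abs_zetaPi_zero_shift_sub_le abs_zetaPi_zero_secondDiff_le)
open BIJ88HkLocHolderTorus (zetaPi secondDiffConst)
open Literature.Analysis.Calculus (exists_abs_deriv_and_deriv_deriv_smoothTransition_le)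

variable {d : ℕ}

/-- **THE HÖLDER MEMBER OF ORDER `1 + θ` OF (2.30) UNDER PLAQUETTE SMALLNESS NEAR `Ω₀` ONLY, FOR `G_{k,loc}(u)` BUILT FROM THE TORUS CUBES AND
WEIGHTS OF RECORD AND THE SMOOTH PRODUCT CUT-OFF `ζ″ = ζ^Π(R₁, R₀)`** (print p. 263: *"ζ_k(x₁, x₂) is a smooth function of x₁ − x₂"*): for
`d + 1 ∈ {2,3}`, `L` odd `> 1`, `a > 0` and every `0 ≤ θ < 1` THERE EXIST `t₀, c₀ > 0` depending on `(d, L, a, θ)` and the universal profile bound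
`C_σ` only such that, for all data as in `derivHolder230_smoothNear_of_smooth` with `1 ≤ R₁ < R₀ ≤ (|T^{(0)}| − 3)/2`,
`(L^k/|x₁ − x₂|_T)^θ·‖U(Γ_{x₁,x₂})(D_uG_{k,loc}(u)f)(x₂, μ) − (D_uG_{k,loc}(u)f)(x₁, μ)‖ ≤ (L^kε)·c₀·m·(1 + L^k((R₀ − R₁)⁻¹ + s⁻¹))²·e^{−t₀D/L^k}·F`
— p29's `derivHolder230_smallPlaquette_zetaPi` under the local hypothesis.
[cite: BalabanImbrieJaffe1988, (2.30) p.263] [cite: BalabanImbrieJaffe1988, (2.32) p.263] [cite: Balaban1983RegularityDecay, Theorem p.573 (1.9)] -/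
theorem derivHolder230_smoothNear_zetaPi (d L : ℕ) (hd1 : 1 ≤ d) (hd3 : d + 1 ≤ 3) (hL : Odd L ∧ 1 < L) {a : ℝ} (ha : 0 < a)
    {θ : ℝ} (hθ0 : 0 ≤ θ) (hθ1 : θ < 1) :
    ∃ t₀ c₀ : ℝ, 0 < t₀ ∧ 0 < c₀ ∧ ∀ (P : Params) (hPd : P.d = d + 1), P.L = L →
      ∀ k : ℕ, 1 ≤ k → k ≤ P.K → 2 * (P.L ^ k - 1) + 4 < P.sitesPerDir 0 → ∀ (c M0 : Fin (d + 1) → ℕ), (∀ i, 1 ≤ M0 i) →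
        (∀ i, c i * P.L ^ k + P.L ^ k * M0 i ≤ P.sitesPerDir 0) → (∀ i, P.L ^ k * M0 i < P.sitesPerDir 0) →
      ∀ (s W : ℕ), 1 ≤ s → ∀ (R R₀ R₁ : ℝ), 4 * (P.L : ℝ) ^ k + 1 < R → 1 ≤ R₁ → R₁ < R₀ → R₀ ≤ ((P.sitesPerDir 0 : ℝ) - 3) / 2 →
        3 * (P.L : ℝ) ^ k ≤ R₀ → 2 * (s : ℝ) / 3 + R₀ / 2 + R ≤ W → (∀ i, ((P.L ^ k * M0 i : ℕ) : ℝ) + R ≤ P.sitesPerDir 0) →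
      ∀ (U : GaugeField P 0 U1) (θp : ℝ), 0 ≤ θp →
        (∀ p : Balaban1983to89.Plaq P 0, (∃ y ∈ (cubeT hPd (P.L ^ k) c fun i => P.L ^ k * M0 i), supDist y p.src ≤ 2 * P.L ^ k) →
          ‖toC (GaugeField.plaqHol U p) - 1‖ ≤ θp) →
        2 * (P.d : ℝ) ^ 3 * (((P.L : ℝ) ^ k) ^ 2 * θp) ^ 2 ≤ 1 →
      ∀ (T : ℝ), ((P.d - 1 : ℕ) : ℝ) * ((P.L : ℝ) ^ k - 1) * θp ≤ T →
        2 * (((P.L : ℝ) ^ k - 1) * (P.L : ℝ) ^ k) * P.d * T ^ 2 + 2 * (P.d * ((P.L : ℝ) ^ k - 1) * T) ^ 2 ≤ 1 / 2 →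
      ∀ (x₁ x₂ : Balaban1983to89.Site P 0) (μ : Fin P.d),
        x₁ ∈ (cubeT hPd (P.L ^ k) c fun i => P.L ^ k * M0 i) →
        (∀ i, R₀ ≤ (boxCoord hPd (P.L ^ k) c x₁ i : ℝ) ∧ (boxCoord hPd (P.L ^ k) c x₁ i : ℝ) + R₀ ≤ (P.L ^ k * M0 i : ℕ) - 1) →
        x₁.shift μ ∈ (cubeT hPd (P.L ^ k) c fun i => P.L ^ k * M0 i) →
        (∀ i, R₀ ≤ (boxCoord hPd (P.L ^ k) c (x₁.shift μ) i : ℝ) ∧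
          (boxCoord hPd (P.L ^ k) c (x₁.shift μ) i : ℝ) + R₀ ≤ (P.L ^ k * M0 i : ℕ) - 1) →
        x₂ ∈ (cubeT hPd (P.L ^ k) c fun i => P.L ^ k * M0 i) →
        (∀ i, R₀ ≤ (boxCoord hPd (P.L ^ k) c x₂ i : ℝ) ∧ (boxCoord hPd (P.L ^ k) c x₂ i : ℝ) + R₀ ≤ (P.L ^ k * M0 i : ℕ) - 1) →
        x₂.shift μ ∈ (cubeT hPd (P.L ^ k) c fun i => P.L ^ k * M0 i) →
        (∀ i, R₀ ≤ (boxCoord hPd (P.L ^ k) c (x₂.shift μ) i : ℝ) ∧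
          (boxCoord hPd (P.L ^ k) c (x₂.shift μ) i : ℝ) + R₀ ≤ (P.L ^ k * M0 i : ℕ) - 1) →
      ∀ (f : Balaban1983to89.Site P 0 → ℂ) (F D : ℝ), (∀ y, ‖f y‖ ≤ F) → 0 ≤ D →
        (∀ y, f y ≠ 0 → D ≤ B5Ineq137Torus.T P 0 x₁ y) → (∀ y, f y ≠ 0 → D ≤ B5Ineq137Torus.T P 0 x₂ y) →
        ((P.L : ℝ) ^ k / B5Ineq137Torus.T P 0 x₁ x₂) ^ θ *
          ‖stairHol U x₁ x₂ *
              covD P.eps⁻¹ (cfg U)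
                (gLocT (B1RG242Torus.α P a k * (P.L : ℝ) ^ (k * P.d)) P.eps⁻¹ U k
                  (cubeFam hPd (P.L ^ k) c M0 s W) (lamFam hPd (P.L ^ k) c M0 s) (zetaPi R₁ R₀ 0) *ᵥ f) ⟨x₂, μ⟩ -
            covD P.eps⁻¹ (cfg U)
                (gLocT (B1RG242Torus.α P a k * (P.L : ℝ) ^ (k * P.d)) P.eps⁻¹ U k
                  (cubeFam hPd (P.L ^ k) c M0 s W) (lamFam hPd (P.L ^ k) c M0 s) (zetaPi R₁ R₀ 0) *ᵥ f) ⟨x₁, μ⟩‖ ≤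
          P.spacing k * (c₀ * (⌊(((P.L : ℝ) ^ k) - 1 + R₀) / s⌋₊ + 3) ^ (d + 1) *
            (1 + (P.L : ℝ) ^ k * ((R₀ - R₁)⁻¹ + (s : ℝ)⁻¹)) ^ 2 * Real.exp (-(t₀ * (((P.L : ℝ) ^ k)⁻¹ * D))) * F) := by
  obtain ⟨C, hC0, hC1, hC2⟩ := exists_abs_deriv_and_deriv_deriv_smoothTransition_le
  have hK₂ : 0 ≤ C ^ 2 + C := by positivity
  obtain ⟨t₀, c₀, ht₀, hc₀, H⟩ := derivHolder230_smoothNear_of_smooth d L hd1 hd3 hL ha hθ0 hθ1 hC0 hK₂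
  refine ⟨t₀, c₀, ht₀, hc₀, ?_⟩
  intro P hPd hPL k hk1 hkK hRsz c M0 hM0 hfit0 hN0 s W hs R R₀ R₁ hR hR₁ hR10 hR₀N hLR₀ hW hgap U θp hθp0 hplaq hθps T hT hsmallT
    x₁ x₂ μ hx₁ hdeep₁ hx₁e hdeep₁e hx₂ hdeep₂ hx₂e hdeep₂e f F D hF hD hsupp₁ hsupp₂
  have e : secondDiffConst C R₁ R₀ = (C ^ 2 + C) / (R₀ - R₁) ^ 2 := by rw [secondDiffConst, div_pow, add_div]
  exact H P hPd hPL k hk1 hkK hRsz c M0 hM0 hfit0 hN0 s W hs R R₀ R₁ hR (zero_le_one.trans hR₁) hR10 hLR₀ hW hgap (zetaPi R₁ R₀ 0)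
    (abs_zetaPi_zero_le_one R₁ R₀) (zetaPi_zero_eq_zero_of_le hR10) (abs_zetaPi_zero_shift_sub_le hC1 hR10)
    (fun x y κ ν => (abs_zetaPi_zero_secondDiff_le hC1 hC2 hR10 hR₁ hR₀N x y κ ν).trans_eq e)
    U θp hθp0 hplaq hθps T hT hsmallT x₁ x₂ μ hx₁ hdeep₁ hx₁e hdeep₁e hx₂ hdeep₂ hx₂e hdeep₂e f F D hF hD hsupp₁ hsupp₂

/-- **THE HÖLDER MEMBER OF ORDER `1 + θ` OF (2.30) UNDER THE PRINTED (2.32) NEAR `Ω₀`** (p. 263: *"in a neighborhood of each □_α there exists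
an A, λ such that u = exp[ie_kη(A + ∂λ)] with |∂A|, |∂*A| ≦ O(p(e_k)). (2.32)"*): `derivHolder230_smoothNear_zetaPi` with the plaquette
hypothesis DISCHARGED from r18's `BIJ88Sect2Statements.SmoothOn e_k η C 𝓅 X B Pl (cfg u)` whenever `Pl` contains the plaquettes based within
`2L^k` of `Ω₀` and `B` their four bonds (p34's `plaqSmall_near_of_smoothOn`: `‖u(∂p) − 1‖ ≤ e_kη²C𝓅` there), the thresholds read at
`θ_p = e_kη²C𝓅` (`0 ≤ e_k`, `0 ≤ C𝓅`).
[cite: BalabanImbrieJaffe1988, (2.30) p.263] [cite: BalabanImbrieJaffe1988, (2.32) p.263] [cite: Balaban1983RegularityDecay, Theorem p.573 (1.9)] -/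
theorem derivHolder230_smoothOn_zetaPi (d L : ℕ) (hd1 : 1 ≤ d) (hd3 : d + 1 ≤ 3) (hL : Odd L ∧ 1 < L) {a : ℝ} (ha : 0 < a)
    {θ : ℝ} (hθ0 : 0 ≤ θ) (hθ1 : θ < 1) :
    ∃ t₀ c₀ : ℝ, 0 < t₀ ∧ 0 < c₀ ∧ ∀ (P : Params) (hPd : P.d = d + 1), P.L = L →
      ∀ k : ℕ, 1 ≤ k → k ≤ P.K → 2 * (P.L ^ k - 1) + 4 < P.sitesPerDir 0 → ∀ (c M0 : Fin (d + 1) → ℕ), (∀ i, 1 ≤ M0 i) →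
        (∀ i, c i * P.L ^ k + P.L ^ k * M0 i ≤ P.sitesPerDir 0) → (∀ i, P.L ^ k * M0 i < P.sitesPerDir 0) →
      ∀ (s W : ℕ), 1 ≤ s → ∀ (R R₀ R₁ : ℝ), 4 * (P.L : ℝ) ^ k + 1 < R → 1 ≤ R₁ → R₁ < R₀ → R₀ ≤ ((P.sitesPerDir 0 : ℝ) - 3) / 2 →
        3 * (P.L : ℝ) ^ k ≤ R₀ → 2 * (s : ℝ) / 3 + R₀ / 2 + R ≤ W → (∀ i, ((P.L ^ k * M0 i : ℕ) : ℝ) + R ≤ P.sitesPerDir 0) →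
      ∀ (U : GaugeField P 0 U1) (ek η Cs pek : ℝ), 0 ≤ ek → 0 ≤ Cs * pek →
      ∀ (X : Finset (Balaban1983to89.Site P 0)) (Bd : Finset (PBond P 0)) (Pl : Finset (Balaban1983to89.Plaq P 0)),
        SmoothOn ek η Cs pek X Bd Pl (cfg U) →
        (∀ p : Balaban1983to89.Plaq P 0, (∃ y ∈ (cubeT hPd (P.L ^ k) c fun i => P.L ^ k * M0 i), supDist y p.src ≤ 2 * P.L ^ k) →
          p ∈ Pl) →
        (∀ p ∈ Pl, (⟨p.src, p.μ⟩ : PBond P 0) ∈ Bd ∧ (⟨p.src.shift p.μ, p.ν⟩ : PBond P 0) ∈ Bd ∧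
          (⟨p.src.shift p.ν, p.μ⟩ : PBond P 0) ∈ Bd ∧ (⟨p.src, p.ν⟩ : PBond P 0) ∈ Bd) →
        2 * (P.d : ℝ) ^ 3 * (((P.L : ℝ) ^ k) ^ 2 * (ek * η ^ 2 * (Cs * pek))) ^ 2 ≤ 1 →
      ∀ (T : ℝ), ((P.d - 1 : ℕ) : ℝ) * ((P.L : ℝ) ^ k - 1) * (ek * η ^ 2 * (Cs * pek)) ≤ T →
        2 * (((P.L : ℝ) ^ k - 1) * (P.L : ℝ) ^ k) * P.d * T ^ 2 + 2 * (P.d * ((P.L : ℝ) ^ k - 1) * T) ^ 2 ≤ 1 / 2 →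
      ∀ (x₁ x₂ : Balaban1983to89.Site P 0) (μ : Fin P.d),
        x₁ ∈ (cubeT hPd (P.L ^ k) c fun i => P.L ^ k * M0 i) →
        (∀ i, R₀ ≤ (boxCoord hPd (P.L ^ k) c x₁ i : ℝ) ∧ (boxCoord hPd (P.L ^ k) c x₁ i : ℝ) + R₀ ≤ (P.L ^ k * M0 i : ℕ) - 1) →
        x₁.shift μ ∈ (cubeT hPd (P.L ^ k) c fun i => P.L ^ k * M0 i) →
        (∀ i, R₀ ≤ (boxCoord hPd (P.L ^ k) c (x₁.shift μ) i : ℝ) ∧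
          (boxCoord hPd (P.L ^ k) c (x₁.shift μ) i : ℝ) + R₀ ≤ (P.L ^ k * M0 i : ℕ) - 1) →
        x₂ ∈ (cubeT hPd (P.L ^ k) c fun i => P.L ^ k * M0 i) →
        (∀ i, R₀ ≤ (boxCoord hPd (P.L ^ k) c x₂ i : ℝ) ∧ (boxCoord hPd (P.L ^ k) c x₂ i : ℝ) + R₀ ≤ (P.L ^ k * M0 i : ℕ) - 1) →
        x₂.shift μ ∈ (cubeT hPd (P.L ^ k) c fun i => P.L ^ k * M0 i) →
        (∀ i, R₀ ≤ (boxCoord hPd (P.L ^ k) c (x₂.shift μ) i : ℝ) ∧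
          (boxCoord hPd (P.L ^ k) c (x₂.shift μ) i : ℝ) + R₀ ≤ (P.L ^ k * M0 i : ℕ) - 1) →
      ∀ (f : Balaban1983to89.Site P 0 → ℂ) (F D : ℝ), (∀ y, ‖f y‖ ≤ F) → 0 ≤ D →
        (∀ y, f y ≠ 0 → D ≤ B5Ineq137Torus.T P 0 x₁ y) → (∀ y, f y ≠ 0 → D ≤ B5Ineq137Torus.T P 0 x₂ y) →
        ((P.L : ℝ) ^ k / B5Ineq137Torus.T P 0 x₁ x₂) ^ θ *
          ‖stairHol U x₁ x₂ *
              covD P.eps⁻¹ (cfg U)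
                (gLocT (B1RG242Torus.α P a k * (P.L : ℝ) ^ (k * P.d)) P.eps⁻¹ U k
                  (cubeFam hPd (P.L ^ k) c M0 s W) (lamFam hPd (P.L ^ k) c M0 s) (zetaPi R₁ R₀ 0) *ᵥ f) ⟨x₂, μ⟩ -
            covD P.eps⁻¹ (cfg U)
                (gLocT (B1RG242Torus.α P a k * (P.L : ℝ) ^ (k * P.d)) P.eps⁻¹ U k
                  (cubeFam hPd (P.L ^ k) c M0 s W) (lamFam hPd (P.L ^ k) c M0 s) (zetaPi R₁ R₀ 0) *ᵥ f) ⟨x₁, μ⟩‖ ≤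
          P.spacing k * (c₀ * (⌊(((P.L : ℝ) ^ k) - 1 + R₀) / s⌋₊ + 3) ^ (d + 1) *
            (1 + (P.L : ℝ) ^ k * ((R₀ - R₁)⁻¹ + (s : ℝ)⁻¹)) ^ 2 * Real.exp (-(t₀ * (((P.L : ℝ) ^ k)⁻¹ * D))) * F) := by
  obtain ⟨t₀, c₀, ht₀, hc₀, H⟩ := derivHolder230_smoothNear_zetaPi d L hd1 hd3 hL ha hθ0 hθ1
  refine ⟨t₀, c₀, ht₀, hc₀, ?_⟩
  intro P hPd hPL k hk1 hkK hRsz c M0 hM0 hfit0 hN0 s W hs R R₀ R₁ hR hR₁ hR10 hR₀N hLR₀ hW hgap U ek η Cs pek hek hCp X Bd Pl hS hPl hBd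
    hθps T hT hsmallT x₁ x₂ μ hx₁ hdeep₁ hx₁e hdeep₁e hx₂ hdeep₂ hx₂e hdeep₂e f F D hF hD hsupp₁ hsupp₂
  exact H P hPd hPL k hk1 hkK hRsz c M0 hM0 hfit0 hN0 s W hs R R₀ R₁ hR hR₁ hR10 hR₀N hLR₀ hW hgap U (ek * η ^ 2 * (Cs * pek))
    (by positivity) (plaqSmall_near_of_smoothOn hek hS hPl hBd) hθps T hT hsmallT x₁ x₂ μ hx₁ hdeep₁ hx₁e hdeep₁e hx₂ hdeep₂ hx₂e hdeep₂e
    f F D hF hD hsupp₁ hsupp₂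

end ZetaPiMember

end

end Literature.MathematicalPhysics.QuantumFieldTheory.BalabanImbrieJaffe1984to88.BIJ88LocDerivHolder230SmoothNearTorus
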